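import Literature.NumberTheory.Sieve.AsymptoticSieveForPrimesAssembly
import Literature.NumberTheory.Sieve.AsymptoticSieveForPrimesReduction
import Literature.NumberTheory.LFunctions.MertensElementary
import HarnessLib

/-!
# Asymptotic sieve for primes: the estimate (5.1) for `T(x; Y, Z)` (proof)

Trunk T-SIEVE. Source: J. Friedlander, H. Iwaniec, *Asymptotic sieve for primes*, Ann. of Math. 148
(1998) 1041–1065 [FriedlanderIwaniecASP1998] (= arXiv:math/9811186), §5 "Estimation of
`T(x; Y, Z)`", p. 1054, display (5.1), with the devices of §4 (p. 1053: (4.3)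
`V_b(x) = ∑_ν λ_ν A_{[ν,b]}(x)`, `g([ν, b]) = g(ν) g(b/(ν, b))`,
`∑_{b ≤ y} μ(b) g(b/(ν,b)) = ∑_{d ∣ ν} μ(d) ∑_{b ≤ y/d, (b,ν)=1} μ(b) g(b)`, "by (2.4), bounded by
`O(σ_ν (log x)^{-6})`", "`∑_ν |λ_ν| g(ν) τ(ν) σ_ν ≪ (log x)²`" [sic: FI write `(log x)^{-5} ∑ ≪ (log x)^{-3}`]).

This file DISCHARGES the named fact `Literature.NumberTheory.Sieve.fi_asp_Tyz_estimate` (FI (5.1),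
`Literature.NumberTheory.Sieve.AsymptoticSieveForPrimesDecomposition`) MODULO the named fact
`Literature.NumberTheory.Sieve.fi_moebius_density_cancellation` (FI (2.4), `…Inputs`), using the proved reduction
`Literature.NumberTheory.Sieve.fi_reduced_remainder_bound_holds` (FI (R′), `…Reduction`):
`fi_asp_Tyz_estimate_of_cancellation : fi_moebius_density_cancellation → fi_asp_Tyz_estimate`.

## The printed proof (FI §5) and its formalisation

"It again suffices to estimate the contribution for given `y, z` and here this is given by the sum
`T(x; y, z) = ∑_{b ≤ y} μ(b) ∑_{c ≤ z} Λ(c) ∑_ν λ_ν A_{[ν,bc]}(x)`. We insert the approximation (1.7)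
for `A_{[ν,bc]}(x)`. For the contribution coming from the main terms … we are now led to estimate
`∑_{b ≤ y} μ(b) ∑^♭_{c ≤ z, c ∤ b} Λ(c) g(bc/(ν,bc)) = ∑_{b ≤ y} μ(b) g(b/(ν,b)) ∑^♭_{c ≤ z, c ∤ b}
Λ(c) g(c/(ν,c))` and by (2.4), (1.8) this is `≪ τ(ν) σ_ν (log y)^{-6} (log νz)`. Summing over `ν`,
as with `T₁(x; y)` we get a contribution `≪ A(x)(log x)^{-3}`. The contribution coming from the
remainder terms is bounded by `∑_ν |λ_ν| ∑_{b ≤ y} ∑^♭_{c ≤ z, c ∤ b} Λ(c)|r_{[ν,bc]}(x)|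
≤ (log yz) ∑_ν ∑^♭_{d ≤ yz} |r_{[ν,d]}(x)| ≪ A(x)(log x)^{-2}` by (R′) since `yz ≤ e²Δ⁻²D < Δ⁻¹D`.
From the two estimates we conclude that (5.1) `T(x; y, z) ≪ A(x)(log x)^{-2}`."

* `SieveSequence.rhoSum_mul_mul_zeta`, `SieveSequence.sum_a_mul_sieveRho_eq_sum_congrSum`
  (FI (4.3)), `SieveSequence.fiTyz_eq_sum_box`: `T(x; y, z) = ∑_{b ≤ y} ∑_{c ≤ z} ∑_{ν ≤ Δ}
  μ(b)Λ(c)λ_ν A_{[bc,ν]}(x)` (weights of level `Δ`);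
* `FIAsymptoticSieveHypotheses.fiTyz_eq_main_add_rem`: insert (1.7) `A_d = g(d)A + r_d`, only
  squarefree `d` occurring by (1.16);
* remainder terms: `sum_fiber_vonMangoldt_le` (`∑_{[bc,ν] = d} Λ(c) ≤ τ(d)² log d`),
  `sum_box_vonMangoldt_abs_remainder_le`, `SieveSequence.abs_fiTyz_remTerms_le`
  (`≤ log x ∑^♭_{d ≤ D} τ₅(d)|r_d(x)|`, the box `yzΔ ≤ D` replacing FI's `yz < Δ⁻¹D`);
* main terms: `fi_mainTerm_pointwise`, `fi_mainTerms_eq` (the rearrangement displayed above, with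
  `g([bc,ν]) = g(ν)g(b/(b,ν))g(c/(c,ν))`, `c` prime, `c ∤ b`), `abs_sum_moebius_density_div_gcd_le`
  ((2.4) with the twist `g(b/(b,ν))`: `≤ τ(ν) K σ_{νc} (log(y/ν))^{-6}`),
  `sum_primes_log_mul_density_div_gcd_le` (`∑^♭_c Λ(c)g(c/(ν,c)) ≤ K'(log z + log 4) + log ν` by
  (1.8) and Mertens), `sum_squarefree_density_card_sigmaHalf_le` (`∑_ν g(ν)τ(ν)σ_ν ≪ (log Δ)²` by
  (1.8)–(1.9)), `abs_fi_mainTerms_le`;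
* `fi_asp_Tyz_estimate_of_cancellation`: in the regime `FIRegime` (`Δ = x^{θ/2}`, `y, z ∈ [Y, eY]`,
  `Y = Δ⁻¹√D`, `0 < θ < 1/3`): `yzΔ ≤ e²D/Δ ≤ D`, `y/Δ ≥ Y/Δ ≥ x^{1/3-θ} ≥ 2`, so the two bounds
  give `|T(x; y, z)| ≤ (C₁ + K_R) A(x)(log x)^{-2}`.

Constants are explicit but immaterial (`∃ K, ∀ᶠ x`), as in the fact.

## Mathlib search

Mathlib: `ArithmeticFunction` convolution API (`coe_mul_zeta_apply`, `vonMangoldt_apply_prime`,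
`vonMangoldt_eq_zero_iff`, `vonMangoldt_sum`), `Nat.squarefree_mul_iff`, `Nat.primeFactors_mul`,
`Nat.Coprime.gcd_mul`, `AntitoneOn.sum_le_integral_Ico`, `integral_rpow`; the tree:
`MertensBound.sum_log_div_prime_le` (`∑_{p ≤ n} log p/p ≤ log n + log 4`,
`Literature.NumberTheory.LFunctions.MertensElementary`), `sum_squarefree_prod_primeFactors_le`,
`prod_one_add_le_exp_sum`, `card_divisors_of_squarefree` (`…Reduction`), the parameter facts
`fiY_pos_and_ge`, `eventually_exp_mul_fiY_le_sqrt` (`…Assembly`). Nothing on `T(x; y, z)`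
(`lean search 'fiTyz|rhoSum'`: only the Decomposition/Assembly files of this series).
-/

noncomputable section

open Filter Finset
open scoped ArithmeticFunction.Moebius ArithmeticFunction.vonMangoldt ArithmeticFunction.zeta
  ArithmeticFunction.omega ArithmeticFunction.sigma

namespace Literature.NumberTheory.Sieve

namespace SieveSequence

/-! ### Unfolding `∑ a_n ρ_n (f₁ * f₂ * 1)(n)` -/

/-- For `1 ≤ n ≤ X`: the pairs `(b, c)` with `1 ≤ b, c ≤ X` and `bc ∣ n` are exactly the
factorisations of the divisors of `n`. [folklore] -/
theorem filter_prod_dvd_eq_biUnion {n X : ℕ} (hn : 1 ≤ n) (hnX : n ≤ X) :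
    ((Icc 1 X) ×ˢ (Icc 1 X)).filter (fun p : ℕ × ℕ => p.1 * p.2 ∣ n) =
      n.divisors.biUnion Nat.divisorsAntidiagonal := by
  ext ⟨b, c⟩
  simp only [Finset.mem_filter, Finset.mem_product, Finset.mem_Icc, Finset.mem_biUnion,
    Nat.mem_divisors, Nat.mem_divisorsAntidiagonal]
  have hn0 : n ≠ 0 := by omega
  constructor
  · rintro ⟨⟨⟨hb1, -⟩, ⟨hc1, -⟩⟩, hbc⟩
    exact ⟨b * c, ⟨hbc, hn0⟩, rfl, Nat.mul_ne_zero (by omega) (by omega)⟩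
  · rintro ⟨m, ⟨hm, -⟩, hbc, hm0⟩
    subst hbc
    have hle : b * c ≤ n := Nat.le_of_dvd (by omega) hm
    have hb : b ≠ 0 := fun h => hm0 (by simp [h])
    have hc : c ≠ 0 := fun h => hm0 (by simp [h])
    refine ⟨⟨⟨Nat.pos_of_ne_zero hb, ?_⟩, ⟨Nat.pos_of_ne_zero hc, ?_⟩⟩, hm⟩
    · calc b ≤ b * c := Nat.le_mul_of_pos_right b (Nat.pos_of_ne_zero hc)
        _ ≤ X := hle.trans hnX
    · calc c ≤ b * c := Nat.le_mul_of_pos_left c (Nat.pos_of_ne_zero hb)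
        _ ≤ X := hle.trans hnX

/-- `(f₁ * f₂ * ζ)(n) = ∑_{1 ≤ b, c ≤ X, bc ∣ n} f₁(b) f₂(c)` for `1 ≤ n ≤ X`. [folklore] -/
theorem mul_mul_zeta_apply_eq_sum_filter (f₁ f₂ : ArithmeticFunction ℝ) {n X : ℕ} (hn : 1 ≤ n)
    (hnX : n ≤ X) :
    (f₁ * f₂ * ζ) n = ∑ p ∈ ((Icc 1 X) ×ˢ (Icc 1 X)).filter (fun p : ℕ × ℕ => p.1 * p.2 ∣ n),
      f₁ p.1 * f₂ p.2 := by
  rw [ArithmeticFunction.coe_mul_zeta_apply, filter_prod_dvd_eq_biUnion hn hnX,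
    Finset.sum_biUnion]
  · simp only [ArithmeticFunction.mul_apply]
  · intro m _ m' _ hmm'
    refine Finset.disjoint_left.mpr fun p hp hp' => hmm' ?_
    rw [Nat.mem_divisorsAntidiagonal] at hp hp'
    rw [← hp.1, ← hp'.1]

/-- **Unfolding the sieve-weighted convolution sums** (FI §5, first display:
`T(x; y, z) = ∑_{b ≤ y} μ(b) ∑_{c ≤ z} Λ(c) ∑_ν λ_ν A_{[ν, bc]}(x)`, first step): for arithmetic
functions `f₁, f₂`, `∑_{n ≤ x} a_n ρ_n (f₁ * f₂ * 1)(n) = ∑_{b ≤ x} ∑_{c ≤ x} f₁(b) f₂(c) V_{bc}(x)`,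
`V_m(x) = ∑_{n ≤ x, m ∣ n} a_n ρ_n` (FI (4.3)).
[cite: FriedlanderIwaniecASP1998, §5] -/
theorem rhoSum_mul_mul_zeta (A : SieveSequence) (lam : ℕ → ℤ) (f₁ f₂ : ArithmeticFunction ℝ)
    (x : ℝ) :
    A.rhoSum lam (f₁ * f₂ * ζ) x =
      ∑ b ∈ Icc 1 ⌊x⌋₊, ∑ c ∈ Icc 1 ⌊x⌋₊, f₁ b * f₂ c *
        (∑ n ∈ (Icc 1 ⌊x⌋₊).filter (b * c ∣ ·), A.a n * (sieveRho lam n : ℝ)) := by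
  classical
  set X := ⌊x⌋₊ with hX
  -- expand the left-hand side
  have hL : A.rhoSum lam (f₁ * f₂ * ζ) x =
      ∑ n ∈ Icc 1 X, ∑ p ∈ (Icc 1 X) ×ˢ (Icc 1 X),
        if p.1 * p.2 ∣ n then A.a n * (sieveRho lam n : ℝ) * (f₁ p.1 * f₂ p.2) else 0 := by
    rw [rhoSum]
    refine Finset.sum_congr rfl fun n hn => ?_
    obtain ⟨hn1, hnX⟩ := Finset.mem_Icc.mp hn
    rw [mul_mul_zeta_apply_eq_sum_filter f₁ f₂ hn1 hnX, Finset.mul_sum, Finset.sum_filter]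
  -- expand the right-hand side
  have hR : ∑ b ∈ Icc 1 X, ∑ c ∈ Icc 1 X, f₁ b * f₂ c *
        (∑ n ∈ (Icc 1 X).filter (b * c ∣ ·), A.a n * (sieveRho lam n : ℝ)) =
      ∑ p ∈ (Icc 1 X) ×ˢ (Icc 1 X), ∑ n ∈ Icc 1 X,
        if p.1 * p.2 ∣ n then A.a n * (sieveRho lam n : ℝ) * (f₁ p.1 * f₂ p.2) else 0 := by
    rw [Finset.sum_product]
    refine Finset.sum_congr rfl fun b _ => Finset.sum_congr rfl fun c _ => ?_
    rw [Finset.mul_sum, Finset.sum_filter]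
    refine Finset.sum_congr rfl fun n _ => ?_
    split_ifs <;> ring
  rw [hL, hR, Finset.sum_comm]

/-- **`V_m(x) = ∑_ν λ_ν A_{[m, ν]}(x)`** (FI (4.3)): expanding `ρ_n = ∑_{ν ∣ n} λ_ν` and using
`m ∣ n ∧ ν ∣ n ↔ [m, ν] ∣ n`; the `ν`-range may be taken to be `1 ≤ ν ≤ x`.
[cite: FriedlanderIwaniecASP1998, §4 (4.3)] -/
theorem sum_a_mul_sieveRho_eq_sum_congrSum (A : SieveSequence) (lam : ℕ → ℤ) (m : ℕ) (x : ℝ) :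
    (∑ n ∈ (Icc 1 ⌊x⌋₊).filter (m ∣ ·), A.a n * (sieveRho lam n : ℝ)) =
      ∑ ν ∈ Icc 1 ⌊x⌋₊, (lam ν : ℝ) * A.congrSum (Nat.lcm m ν) x := by
  classical
  set X := ⌊x⌋₊ with hX
  have hIcc : Icc 1 X = Ioc 0 X := by
    ext n; simp [Finset.mem_Icc, Finset.mem_Ioc]; omega
  -- left-hand side
  have hL : (∑ n ∈ (Icc 1 X).filter (m ∣ ·), A.a n * (sieveRho lam n : ℝ)) =
      ∑ n ∈ Icc 1 X, ∑ ν ∈ Icc 1 X, if m ∣ n ∧ ν ∣ n then A.a n * (lam ν : ℝ) else 0 := by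
    rw [Finset.sum_filter]
    refine Finset.sum_congr rfl fun n hn => ?_
    obtain ⟨hn1, hnX⟩ := Finset.mem_Icc.mp hn
    split_ifs with hmn
    · rw [sieveRho, Int.cast_sum, Finset.mul_sum]
      -- `divisors n = (Icc 1 X).filter (· ∣ n)`
      have hdiv : n.divisors = (Icc 1 X).filter (· ∣ n) := by
        ext ν
        simp only [Nat.mem_divisors, Finset.mem_filter, Finset.mem_Icc]
        constructor
        · rintro ⟨hν, hn0⟩
          exact ⟨⟨Nat.pos_of_dvd_of_pos hν (by omega), (Nat.le_of_dvd (by omega) hν).trans hnX⟩, hν⟩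
        · rintro ⟨-, hν⟩; exact ⟨hν, by omega⟩
      rw [hdiv, Finset.sum_filter]
      refine Finset.sum_congr rfl fun ν _ => ?_
      simp only [hmn, true_and]
    · symm
      refine Finset.sum_eq_zero fun ν _ => ?_
      simp [hmn]
  -- right-hand side
  have hR : ∑ ν ∈ Icc 1 X, (lam ν : ℝ) * A.congrSum (Nat.lcm m ν) x =
      ∑ ν ∈ Icc 1 X, ∑ n ∈ Icc 1 X, if m ∣ n ∧ ν ∣ n then A.a n * (lam ν : ℝ) else 0 := by
    refine Finset.sum_congr rfl fun ν _ => ?_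
    rw [congrSum, ← hIcc, Finset.mul_sum, Finset.sum_filter]
    refine Finset.sum_congr rfl fun n _ => ?_
    simp only [Nat.lcm_dvd_iff]
    split_ifs <;> ring
  rw [hL, hR, Finset.sum_comm]

end SieveSequence

/-! ### Squarefree `lcm`s and the density -/

/-- `[m, ν] = ν · (m / (m, ν))`. [folklore] -/
theorem lcm_eq_mul_div_gcd (m ν : ℕ) : Nat.lcm m ν = ν * (m / Nat.gcd m ν) := by
  rw [Nat.lcm_eq_mul_div, mul_comm ν, Nat.div_mul_right_comm (Nat.gcd_dvd_left m ν)]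

/-- For squarefree `m` and `ν ≠ 0`, `[m, ν]` is squarefree iff `ν` is. [folklore] -/
theorem squarefree_lcm_iff_of_squarefree {m ν : ℕ} (hm : Squarefree m) (hν : ν ≠ 0) :
    Squarefree (Nat.lcm m ν) ↔ Squarefree ν := by
  constructor
  · intro h
    exact h.squarefree_of_dvd (Nat.dvd_lcm_right m ν)
  · intro hνs
    rw [lcm_eq_mul_div_gcd, Nat.squarefree_mul_iff]
    refine ⟨(Nat.coprime_div_gcd_of_squarefree hm hν).symm, hνs, ?_⟩
    exact hm.squarefree_of_dvd (Nat.div_dvd_of_dvd (Nat.gcd_dvd_left m ν))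

/-- `[m, ν]` squarefree forces `m` squarefree. [folklore] -/
theorem Squarefree.of_lcm_left {m ν : ℕ} (h : Squarefree (Nat.lcm m ν)) : Squarefree m :=
  h.squarefree_of_dvd (Nat.dvd_lcm_left m ν)

/-- `[m, ν]` squarefree forces `ν` squarefree. [folklore] -/
theorem Squarefree.of_lcm_right {m ν : ℕ} (h : Squarefree (Nat.lcm m ν)) : Squarefree ν :=
  h.squarefree_of_dvd (Nat.dvd_lcm_right m ν)

/-- Multiplicativity across an `lcm`: `g([m, ν]) = g(ν) g(m/(m, ν))` for squarefree `m`, `ν ≠ 0`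
(FI §4: "`g([ν, b]) = g(ν) g(b/(ν, b))`"). [cite: FriedlanderIwaniecASP1998, §4 (4.3)] -/
theorem ArithmeticFunction.IsMultiplicative.map_lcm_of_squarefree {R : Type*} [CommMonoidWithZero R]
    {g : ArithmeticFunction R} (hg : g.IsMultiplicative) {m ν : ℕ} (hm : Squarefree m) (hν : ν ≠ 0) :
    g (Nat.lcm m ν) = g ν * g (m / Nat.gcd m ν) := by
  rw [lcm_eq_mul_div_gcd, hg.map_mul_of_coprime (Nat.coprime_div_gcd_of_squarefree hm hν).symm]

/-- For coprime `b, c`: `bc/(bc, ν) = (b/(b, ν)) · (c/(c, ν))`, with coprime factors. [folklore] -/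
theorem mul_div_gcd_eq_of_coprime {b c : ℕ} (hbc : b.Coprime c) (ν : ℕ) :
    b * c / Nat.gcd (b * c) ν = (b / Nat.gcd b ν) * (c / Nat.gcd c ν) ∧
      (b / Nat.gcd b ν).Coprime (c / Nat.gcd c ν) := by
  have hg : Nat.gcd (b * c) ν = Nat.gcd b ν * Nat.gcd c ν := by
    rw [Nat.gcd_comm, Nat.Coprime.gcd_mul ν hbc, Nat.gcd_comm ν b, Nat.gcd_comm ν c]
  refine ⟨?_, ?_⟩
  · rw [hg, Nat.mul_div_mul_comm (Nat.gcd_dvd_left b ν) (Nat.gcd_dvd_left c ν)]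
  · exact Nat.Coprime.coprime_dvd_left (Nat.div_dvd_of_dvd (Nat.gcd_dvd_left b ν))
      (Nat.Coprime.coprime_dvd_right (Nat.div_dvd_of_dvd (Nat.gcd_dvd_left c ν)) hbc)

/-- For a prime `c`: `c/(c, ν) = 1` if `c ∣ ν` and `= c` otherwise. [folklore] -/
theorem Nat.Prime.div_gcd_eq {c : ℕ} (hc : c.Prime) (ν : ℕ) :
    c / Nat.gcd c ν = if c ∣ ν then 1 else c := by
  split_ifs with h
  · rw [Nat.gcd_eq_left h, Nat.div_self hc.pos]
  · rw [(hc.coprime_iff_not_dvd.mpr h).gcd_eq_one, Nat.div_one]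

/-! ### The Möbius–density cancellation with a `gcd` twist -/

/-- **(2.4) with the twist `g(b/(b, ν))` and a coprimality condition** (FI §4: "`∑_{b ≤ y} μ(b)
g(b/(ν, b)) = ∑_{d ∣ ν} μ(d) ∑_{b ≤ y/d, (b, ν) = 1} μ(b) g(b)`. This last inner sum is, by (2.4),
bounded by `O(σ_ν (log x)^{-6})`"; §5 with the extra condition `c ∤ b`). For squarefree `ν`, `k ≥ 1`
and `y ≥ 2ν`: `|∑_{b ≤ y, b sqfree, (b, k) = 1} μ(b) g(b/(b, ν))| ≤ τ(ν) |K| σ_{νk} / (log(y/ν))⁶`,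
where `K` is the constant of (2.4) (`fi_moebius_density_cancellation`). Proof: `b = η b'` with
`η = (b, ν)`, `(b', νk) = 1`. [cite: FriedlanderIwaniecASP1998, §4 p. 1053] -/
theorem abs_sum_moebius_density_div_gcd_le {g : ArithmeticFunction ℝ} {K : ℝ}
    (h24 : ∀ ν : ℕ, 1 ≤ ν → ∀ y : ℝ, 2 ≤ y →
      |∑ d ∈ (Icc 1 ⌊y⌋₊).filter (fun d : ℕ => d.Coprime ν), (μ d : ℝ) * g d| ≤
        K * sigmaHalf ν / Real.log y ^ 6)
    {ν k : ℕ} (hν : Squarefree ν) (hk : 1 ≤ k) {y : ℝ} (hy : 2 * (ν : ℝ) ≤ y) :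
    |∑ b ∈ (Icc 1 ⌊y⌋₊).filter (fun b : ℕ => Squarefree b ∧ b.Coprime k),
        (μ b : ℝ) * g (b / Nat.gcd b ν)| ≤
      (ν.divisors.card : ℝ) * (|K| * sigmaHalf (ν * k) / Real.log (y / ν) ^ 6) := by
  classical
  have hν0 : ν ≠ 0 := hν.ne_zero
  have hν1 : (1 : ℝ) ≤ ν := by exact_mod_cast Nat.pos_of_ne_zero hν0
  have hy0 : 0 ≤ y := by linarith
  have hyν : 2 ≤ y / ν := by rw [le_div_iff₀ (by linarith)]; linarith
  have hlogyν : 0 < Real.log (y / ν) := Real.log_pos (by linarith)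
  set U := (Icc 1 ⌊y⌋₊).filter (fun b : ℕ => Squarefree b ∧ b.Coprime k) with hU
  set S := ν.divisors.filter (fun η : ℕ => η.Coprime k) with hS
  set t : ℕ → Finset ℕ := fun η =>
    (Icc 1 ⌊y / η⌋₊).filter (fun b' : ℕ => Squarefree b' ∧ b'.Coprime (ν * k)) with ht
  -- the bijection `b ↦ ((b, ν), b/(b, ν))`
  have hbij : ∑ b ∈ U, (μ b : ℝ) * g (b / Nat.gcd b ν) =
      ∑ p ∈ S.sigma t, (μ p.1 : ℝ) * ((μ p.2 : ℝ) * g p.2) := by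
    refine Finset.sum_nbij' (fun b => (⟨Nat.gcd b ν, b / Nat.gcd b ν⟩ : Σ _ : ℕ, ℕ))
      (fun p => p.1 * p.2) ?_ ?_ ?_ ?_ ?_
    · -- into `S.sigma t`
      intro b hb
      obtain ⟨hb1, hbsq, hbk⟩ := Finset.mem_filter.mp hb
      obtain ⟨hb1', hby⟩ := Finset.mem_Icc.mp hb1
      have hη : Nat.gcd b ν ∣ ν := Nat.gcd_dvd_right b ν
      have hηb : Nat.gcd b ν ∣ b := Nat.gcd_dvd_left b ν
      have hη0 : 0 < Nat.gcd b ν := Nat.gcd_pos_of_pos_left ν hb1'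
      refine Finset.mem_sigma.mpr ⟨Finset.mem_filter.mpr ⟨Nat.mem_divisors.mpr ⟨hη, hν0⟩,
        Nat.Coprime.coprime_dvd_left hηb hbk⟩, Finset.mem_filter.mpr ⟨?_, ?_, ?_⟩⟩
      · refine Finset.mem_Icc.mpr ⟨Nat.div_pos (Nat.le_of_dvd hb1' hηb) hη0, Nat.le_floor ?_⟩
        rw [Nat.cast_div hηb (by exact_mod_cast hη0.ne'), div_le_div_iff_of_pos_right (by exact_mod_cast hη0)]
        exact (Nat.cast_le.mpr hby).trans (Nat.floor_le hy0)
      · exact hbsq.squarefree_of_dvd (Nat.div_dvd_of_dvd hηb)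
      · exact Nat.Coprime.mul_right (Nat.coprime_div_gcd_of_squarefree hbsq hν0)
          (Nat.Coprime.coprime_dvd_left (Nat.div_dvd_of_dvd hηb) hbk)
    · -- back into `U`
      rintro ⟨η, b'⟩ hp
      obtain ⟨hη, hb'⟩ := Finset.mem_sigma.mp hp
      obtain ⟨hη1, hηk⟩ := Finset.mem_filter.mp hη
      obtain ⟨hη2, -⟩ := Nat.mem_divisors.mp hη1
      obtain ⟨hb'1, hb'sq, hb'k⟩ := Finset.mem_filter.mp hb'
      obtain ⟨hb'1', hb'y⟩ := Finset.mem_Icc.mp hb'1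
      have hη0 : 0 < η := Nat.pos_of_dvd_of_pos hη2 (Nat.pos_of_ne_zero hν0)
      have hcop : η.Coprime b' :=
        (Nat.Coprime.coprime_dvd_right hη2 (Nat.Coprime.coprime_mul_right_right hb'k)).symm
      refine Finset.mem_filter.mpr ⟨Finset.mem_Icc.mpr ⟨Nat.mul_pos hη0 hb'1', ?_⟩, ?_, ?_⟩
      · refine Nat.le_floor ?_
        have : (b' : ℝ) ≤ y / η := (Nat.cast_le.mpr hb'y).trans (Nat.floor_le (by positivity))
        rw [le_div_iff₀ (by exact_mod_cast hη0)] at this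
        push_cast
        linarith
      · exact Nat.squarefree_mul_iff.mpr ⟨hcop, hν.squarefree_of_dvd hη2, hb'sq⟩
      · exact Nat.Coprime.mul_left hηk (Nat.Coprime.coprime_mul_left_right hb'k)
    · -- left inverse
      intro b _
      exact Nat.mul_div_cancel' (Nat.gcd_dvd_left b ν)
    · -- right inverse
      rintro ⟨η, b'⟩ hp
      dsimp only at hp ⊢
      obtain ⟨hη, hb'⟩ := Finset.mem_sigma.mp hp
      obtain ⟨hη1, -⟩ := Finset.mem_filter.mp hη
      obtain ⟨hη2, -⟩ := Nat.mem_divisors.mp hη1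
      obtain ⟨-, -, hb'k⟩ := Finset.mem_filter.mp hb'
      have hη0 : 0 < η := Nat.pos_of_dvd_of_pos hη2 (Nat.pos_of_ne_zero hν0)
      have hgcd : Nat.gcd (η * b') ν = η := by
        obtain ⟨q, hq⟩ := hη2
        have hb'q : b'.Coprime q :=
          Nat.Coprime.coprime_dvd_right ⟨η, by rw [hq, mul_comm]⟩
            (Nat.Coprime.coprime_mul_right_right hb'k)
        conv_lhs => rw [hq]
        rw [Nat.gcd_mul_left, hb'q.gcd_eq_one, mul_one]
      simp only [hgcd, Nat.mul_div_cancel_left b' hη0]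
    · -- the summands agree
      intro b hb
      obtain ⟨-, hbsq, -⟩ := Finset.mem_filter.mp hb
      have hηb : Nat.gcd b ν ∣ b := Nat.gcd_dvd_left b ν
      have hsplit : b = Nat.gcd b ν * (b / Nat.gcd b ν) := (Nat.mul_div_cancel' hηb).symm
      have hcop : (Nat.gcd b ν).Coprime (b / Nat.gcd b ν) := by
        refine Nat.coprime_of_squarefree_mul ?_
        rwa [← hsplit]
      have hμ : (μ b : ℝ) = (μ (Nat.gcd b ν) : ℝ) * (μ (b / Nat.gcd b ν) : ℝ) := by
        conv_lhs => rw [hsplit]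
        rw [ArithmeticFunction.isMultiplicative_moebius.map_mul_of_coprime hcop, Int.cast_mul]
      simp only
      rw [hμ]
      ring
  rw [hbij, Finset.sum_sigma]
  -- bound each inner sum by (2.4)
  have hinner : ∀ η ∈ S, |∑ b' ∈ t η, (μ b' : ℝ) * g b'| ≤ |K| * sigmaHalf (ν * k) / Real.log (y / ν) ^ 6 := by
    intro η hη
    obtain ⟨hη1, -⟩ := Finset.mem_filter.mp hη
    obtain ⟨hη2, -⟩ := Nat.mem_divisors.mp hη1
    have hη0 : 0 < η := Nat.pos_of_dvd_of_pos hη2 (Nat.pos_of_ne_zero hν0)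
    have hην : (η : ℝ) ≤ ν := by exact_mod_cast Nat.le_of_dvd (Nat.pos_of_ne_zero hν0) hη2
    have hyη : y / ν ≤ y / η := div_le_div_of_nonneg_left hy0 (by exact_mod_cast hη0) hην
    have hyη2 : 2 ≤ y / η := hyν.trans hyη
    -- drop the squarefree condition (μ vanishes elsewhere) and apply (2.4)
    have hdrop : ∑ b' ∈ t η, (μ b' : ℝ) * g b' =
        ∑ b' ∈ (Icc 1 ⌊y / η⌋₊).filter (fun b' : ℕ => b'.Coprime (ν * k)), (μ b' : ℝ) * g b' := by
      have : (Icc 1 ⌊y / (η : ℝ)⌋₊).filter (fun b' : ℕ => Squarefree b' ∧ b'.Coprime (ν * k)) =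
          ((Icc 1 ⌊y / (η : ℝ)⌋₊).filter (fun b' : ℕ => b'.Coprime (ν * k))).filter Squarefree := by
        ext b'; simp only [Finset.mem_filter]; tauto
      simp only [ht]
      rw [this, Finset.sum_filter_of_ne]
      intro b' _ hne
      by_contra hsq
      apply hne
      rw [ArithmeticFunction.moebius_eq_zero_of_not_squarefree hsq, Int.cast_zero, zero_mul]
    rw [hdrop]
    have h := h24 (ν * k) (Nat.mul_pos (Nat.pos_of_ne_zero hν0) hk) (y / η) hyη2
    refine h.trans ?_
    have hσ : 0 ≤ sigmaHalf (ν * k) := zero_le_one.trans (one_le_sigmaHalf _)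
    have hlogη : Real.log (y / ν) ≤ Real.log (y / η) := Real.log_le_log (by linarith) hyη
    calc K * sigmaHalf (ν * k) / Real.log (y / ↑η) ^ 6
        ≤ |K| * sigmaHalf (ν * k) / Real.log (y / ↑η) ^ 6 := by
          gcongr; exact le_abs_self K
      _ ≤ |K| * sigmaHalf (ν * k) / Real.log (y / ν) ^ 6 := by
          refine div_le_div_of_nonneg_left (by positivity) (by positivity) ?_
          gcongr
  calc |∑ η ∈ S, ∑ b' ∈ t η, (μ (⟨η, b'⟩ : Σ _ : ℕ, ℕ).1 : ℝ) * ((μ (⟨η, b'⟩ : Σ _ : ℕ, ℕ).2 : ℝ) * g b')|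
      ≤ ∑ η ∈ S, |∑ b' ∈ t η, (μ η : ℝ) * ((μ b' : ℝ) * g b')| := Finset.abs_sum_le_sum_abs _ _
    _ = ∑ η ∈ S, |(μ η : ℝ)| * |∑ b' ∈ t η, (μ b' : ℝ) * g b'| := by
        refine Finset.sum_congr rfl fun η _ => ?_
        rw [← Finset.mul_sum, abs_mul]
    _ ≤ ∑ η ∈ S, 1 * (|K| * sigmaHalf (ν * k) / Real.log (y / ν) ^ 6) := by
        refine Finset.sum_le_sum fun η hη => mul_le_mul ?_ (hinner η hη) (abs_nonneg _) zero_le_one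
        exact_mod_cast ArithmeticFunction.abs_moebius_le_one
    _ = (S.card : ℝ) * (|K| * sigmaHalf (ν * k) / Real.log (y / ν) ^ 6) := by
        rw [Finset.sum_const, nsmul_eq_mul, one_mul]
    _ ≤ (ν.divisors.card : ℝ) * (|K| * sigmaHalf (ν * k) / Real.log (y / ν) ^ 6) := by
        refine mul_le_mul_of_nonneg_right ?_ (div_nonneg (mul_nonneg (abs_nonneg _)
          (zero_le_one.trans (one_le_sigmaHalf _))) (pow_nonneg hlogyν.le _))
        exact_mod_cast Finset.card_filter_le _ _

/-! ### The remainder terms of `T(x; y, z)`: reindexing by `d = [bc, ν]` -/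

/-- Fiber weight: for squarefree `d`, `∑_{(b, c, ν) : [bc, ν] = d} Λ(c) ≤ τ(d)² log d`, the triples
ranging over any box of positive integers (FI §5: the pairs `(ν, d')` with `[ν, d'] = d` number at most
`τ₃(d)`, and `∑_{bc = d'} Λ(c) = log d'`). [cite: FriedlanderIwaniecASP1998, §5 (5.1)] -/
theorem sum_fiber_vonMangoldt_le {d : ℕ} (hd : d ≠ 0) (J : Finset ((ℕ × ℕ) × ℕ))
    (hJ : ∀ j ∈ J, 1 ≤ j.1.1 ∧ 1 ≤ j.1.2 ∧ 1 ≤ j.2) :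
    ∑ j ∈ J.filter (fun j => Nat.lcm (j.1.1 * j.1.2) j.2 = d), Λ j.1.2 ≤
      ((d.divisors.card : ℝ)) ^ 2 * Real.log d := by
  classical
  -- inject the fiber into `divisors d × {(b, c) : bc ∣ d}`
  set P := ((Icc 1 d) ×ˢ (Icc 1 d)).filter (fun p : ℕ × ℕ => p.1 * p.2 ∣ d) with hP
  have hinj : Set.InjOn (fun j : (ℕ × ℕ) × ℕ => (j.2, j.1)) ↑(J.filter (fun j => Nat.lcm (j.1.1 * j.1.2) j.2 = d)) := by
    rintro ⟨⟨b, c⟩, ν⟩ _ ⟨⟨b', c'⟩, ν'⟩ _ h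
    simp only [Prod.mk.injEq] at h
    obtain ⟨rfl, rfl, rfl⟩ := h
    rfl
  have h1 : ∑ j ∈ J.filter (fun j => Nat.lcm (j.1.1 * j.1.2) j.2 = d), Λ j.1.2 =
      ∑ q ∈ (J.filter (fun j => Nat.lcm (j.1.1 * j.1.2) j.2 = d)).image (fun j : (ℕ × ℕ) × ℕ => (j.2, j.1)),
        Λ q.2.2 := by
    rw [Finset.sum_image hinj]
  rw [h1]
  have h2 : (J.filter (fun j => Nat.lcm (j.1.1 * j.1.2) j.2 = d)).image (fun j : (ℕ × ℕ) × ℕ => (j.2, j.1)) ⊆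
      d.divisors ×ˢ P := by
    intro q hq
    obtain ⟨⟨⟨b, c⟩, ν⟩, hj, rfl⟩ := Finset.mem_image.mp hq
    obtain ⟨hjJ, hjd⟩ := Finset.mem_filter.mp hj
    obtain ⟨hb1, hc1, hν1⟩ := hJ _ hjJ
    simp only at hjd hb1 hc1 hν1
    have hbc : b * c ∣ d := hjd ▸ Nat.dvd_lcm_left (b * c) ν
    have hνd : ν ∣ d := hjd ▸ Nat.dvd_lcm_right (b * c) ν
    have hbcle : b * c ≤ d := Nat.le_of_dvd (Nat.pos_of_ne_zero hd) hbc
    refine Finset.mem_product.mpr ⟨Nat.mem_divisors.mpr ⟨hνd, hd⟩, Finset.mem_filter.mpr ⟨?_, hbc⟩⟩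
    refine Finset.mem_product.mpr ⟨Finset.mem_Icc.mpr ⟨hb1, ?_⟩, Finset.mem_Icc.mpr ⟨hc1, ?_⟩⟩
    · exact le_trans (Nat.le_mul_of_pos_right b hc1) hbcle
    · exact le_trans (Nat.le_mul_of_pos_left c hb1) hbcle
  refine (Finset.sum_le_sum_of_subset_of_nonneg h2 fun q _ _ => ArithmeticFunction.vonMangoldt_nonneg).trans ?_
  rw [Finset.sum_product]
  simp only [Finset.sum_const, nsmul_eq_mul]
  -- `∑_{(b,c) : bc ∣ d} Λ(c) = ∑_{m ∣ d} log m ≤ τ(d) log d`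
  have h3 : ∑ p ∈ P, Λ p.2 = ∑ m ∈ d.divisors, Real.log m := by
    rw [hP, SieveSequence.filter_prod_dvd_eq_biUnion (Nat.pos_of_ne_zero hd) le_rfl, Finset.sum_biUnion]
    · refine Finset.sum_congr rfl fun m _ => ?_
      rw [Nat.sum_divisorsAntidiagonal' (fun _ c => Λ c), ArithmeticFunction.vonMangoldt_sum]
    · intro m _ m' _ hmm'
      refine Finset.disjoint_left.mpr fun p hp hp' => hmm' ?_
      rw [Nat.mem_divisorsAntidiagonal] at hp hp'
      rw [← hp.1, ← hp'.1]
  have h4 : ∑ m ∈ d.divisors, Real.log m ≤ (d.divisors.card : ℝ) * Real.log d := by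
    calc ∑ m ∈ d.divisors, Real.log m ≤ ∑ m ∈ d.divisors, Real.log d := by
          refine Finset.sum_le_sum fun m hm => Real.log_le_log ?_ ?_
          · exact_mod_cast Nat.pos_of_mem_divisors hm
          · exact_mod_cast Nat.divisor_le hm
      _ = (d.divisors.card : ℝ) * Real.log d := by rw [Finset.sum_const, nsmul_eq_mul]
  calc (d.divisors.card : ℝ) * ∑ p ∈ P, Λ p.2 = (d.divisors.card : ℝ) * ∑ m ∈ d.divisors, Real.log m := by
        rw [h3]
    _ ≤ (d.divisors.card : ℝ) * ((d.divisors.card : ℝ) * Real.log d) :=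
        mul_le_mul_of_nonneg_left h4 (Nat.cast_nonneg _)
    _ = ((d.divisors.card : ℝ)) ^ 2 * Real.log d := by ring

/-- `τ(d)² ≤ τ₅(d)` for squarefree `d` (`4^ω ≤ 5^ω`). [folklore] -/
theorem card_divisors_sq_le_divisorCountK_five {d : ℕ} (hd : Squarefree d) :
    ((d.divisors.card : ℝ)) ^ 2 ≤ (divisorCountK 5 d : ℝ) := by
  rw [card_divisors_of_squarefree hd, divisorCountK_apply_of_squarefree 5 hd,
    ← card_primeFactors_eq_cardDistinctFactors]
  push_cast
  rw [← pow_mul, mul_comm, pow_mul]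
  norm_num
  exact pow_le_pow_left₀ (by norm_num) (by norm_num) _

variable {A : SieveSequence} {D δ Δ : ℝ → ℝ}

/-- **The remainder terms of `T(x; y, z)`** (FI §5: "The contribution coming from the remainder terms
is bounded by `∑_ν |λ_ν| ∑_{b ≤ y} ∑^♭_{c ≤ z} Λ(c)|r_{[ν,bc]}(x)| ≤ (log yz) ∑_ν ∑^♭_{d ≤ yz}
|r_{[ν,d]}(x)| ≪ A(x)(log x)^{-2}` by (R′) since `yz ≤ e²Δ⁻²D < Δ⁻¹D`"): for a box
`b ≤ B`, `c ≤ C`, `ν ≤ N` with `BCN ≤ D(x) ≤ x`,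
`∑_{[bc,ν] sqfree} Λ(c) |r_{[bc,ν]}(x)| ≤ log x · ∑_{d ≤ D(x) sqfree} τ₅(d) |r_d(x)|`.
[cite: FriedlanderIwaniecASP1998, §5 (5.1)] -/
theorem sum_box_vonMangoldt_abs_remainder_le (A : SieveSequence) {D : ℝ → ℝ} {x : ℝ}
    {B C N : ℕ} (hbox : ((B * C * N : ℕ) : ℝ) ≤ D x) (hDx : D x ≤ x) :
    ∑ j ∈ ((Icc 1 B) ×ˢ (Icc 1 C)) ×ˢ (Icc 1 N),
        (if Squarefree (Nat.lcm (j.1.1 * j.1.2) j.2) then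
          Λ j.1.2 * |A.remainder (Nat.lcm (j.1.1 * j.1.2) j.2) x| else 0) ≤
      Real.log x * ∑ d ∈ (Icc 1 ⌊D x⌋₊).filter Squarefree, (divisorCountK 5 d : ℝ) * |A.remainder d x| := by
  classical
  set Box := ((Icc 1 B) ×ˢ (Icc 1 C)) ×ˢ (Icc 1 N) with hBox
  set φ : (ℕ × ℕ) × ℕ → ℕ := fun j => Nat.lcm (j.1.1 * j.1.2) j.2 with hφ
  set J := Box.filter (fun j => Squarefree (φ j)) with hJ
  set S := (Icc 1 ⌊D x⌋₊).filter Squarefree with hS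
  have hBox1 : ∀ j ∈ Box, 1 ≤ j.1.1 ∧ 1 ≤ j.1.2 ∧ 1 ≤ j.2 := by
    rintro ⟨⟨b, c⟩, ν⟩ hj
    simp only [hBox, Finset.mem_product, Finset.mem_Icc] at hj
    exact ⟨hj.1.1.1, hj.1.2.1, hj.2.1⟩
  rw [← Finset.sum_filter]
  change ∑ j ∈ J, Λ j.1.2 * |A.remainder (φ j) x| ≤ _
  -- `φ` maps `J` into `S`
  have hmaps : ∀ j ∈ J, φ j ∈ S := by
    rintro ⟨⟨b, c⟩, ν⟩ hj
    obtain ⟨hjB, hsq⟩ := Finset.mem_filter.mp hj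
    simp only [hBox, Finset.mem_product, Finset.mem_Icc] at hjB
    obtain ⟨⟨⟨hb1, hbB⟩, ⟨hc1, hcC⟩⟩, ⟨hν1, hνN⟩⟩ := hjB
    have hpos : 0 < Nat.lcm (b * c) ν := Nat.lcm_pos (Nat.mul_pos hb1 hc1) hν1
    refine Finset.mem_filter.mpr ⟨Finset.mem_Icc.mpr ⟨hpos, Nat.le_floor ?_⟩, hsq⟩
    have hle : Nat.lcm (b * c) ν ≤ b * c * ν := by
      rw [Nat.lcm_eq_mul_div]
      exact Nat.div_le_self _ _
    have hle' : b * c * ν ≤ B * C * N :=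
      Nat.mul_le_mul (Nat.mul_le_mul hbB hcC) hνN
    calc ((Nat.lcm (b * c) ν : ℕ) : ℝ) ≤ ((B * C * N : ℕ) : ℝ) := by exact_mod_cast hle.trans hle'
      _ ≤ D x := hbox
  rw [← Finset.sum_fiberwise_of_maps_to hmaps]
  -- on each fiber the remainder factor is constant
  have hfib : ∀ d ∈ S, ∑ j ∈ J.filter (fun j => φ j = d), Λ j.1.2 * |A.remainder (φ j) x| =
      |A.remainder d x| * ∑ j ∈ J.filter (fun j => φ j = d), Λ j.1.2 := by
    intro d _
    rw [Finset.mul_sum]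
    refine Finset.sum_congr rfl fun j hj => ?_
    rw [(Finset.mem_filter.mp hj).2]
    ring
  rw [Finset.sum_congr rfl hfib, Finset.mul_sum]
  refine Finset.sum_le_sum fun d hd => ?_
  obtain ⟨hd1, hdsq⟩ := Finset.mem_filter.mp hd
  obtain ⟨hd1', hdD⟩ := Finset.mem_Icc.mp hd1
  have hd0 : d ≠ 0 := by omega
  -- fiber weight
  have hW : ∑ j ∈ J.filter (fun j => φ j = d), Λ j.1.2 ≤ ((d.divisors.card : ℝ)) ^ 2 * Real.log d := by
    have hsub : J.filter (fun j => φ j = d) ⊆ Box.filter (fun j => Nat.lcm (j.1.1 * j.1.2) j.2 = d) := by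
      intro j hj
      obtain ⟨hjJ, hjd⟩ := Finset.mem_filter.mp hj
      exact Finset.mem_filter.mpr ⟨(Finset.mem_filter.mp hjJ).1, hjd⟩
    refine (Finset.sum_le_sum_of_subset_of_nonneg hsub fun j _ _ => ArithmeticFunction.vonMangoldt_nonneg).trans ?_
    exact sum_fiber_vonMangoldt_le hd0 Box hBox1
  have hlogd : Real.log d ≤ Real.log x := by
    refine Real.log_le_log (by exact_mod_cast hd1') ?_
    exact ((Nat.cast_le.mpr hdD).trans (Nat.floor_le (by linarith [hbox, hDx,
      (Nat.cast_nonneg (B * C * N) : (0:ℝ) ≤ _)]))).trans hDx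
  have hlogd0 : 0 ≤ Real.log d := Real.log_nonneg (by exact_mod_cast hd1')
  calc |A.remainder d x| * ∑ j ∈ J.filter (fun j => φ j = d), Λ j.1.2
      ≤ |A.remainder d x| * (((d.divisors.card : ℝ)) ^ 2 * Real.log d) :=
        mul_le_mul_of_nonneg_left hW (abs_nonneg _)
    _ ≤ |A.remainder d x| * ((divisorCountK 5 d : ℝ) * Real.log x) := by
        refine mul_le_mul_of_nonneg_left ?_ (abs_nonneg _)
        exact mul_le_mul (card_divisors_sq_le_divisorCountK_five hdsq) hlogd hlogd0 (by positivity)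
    _ = Real.log x * ((divisorCountK 5 d : ℝ) * |A.remainder d x|) := by ring

/-! ### The main terms of `T(x; y, z)`: auxiliary bounds -/

/-- `∑_{n ≤ X} n^{-3/2} ≤ 3` (compare with `∫_1^X t^{-3/2} dt ≤ 2`). [folklore] -/
theorem sum_Icc_rpow_neg_three_halves_le (X : ℕ) :
    ∑ n ∈ Icc 1 X, ((n : ℝ)) ^ (-(3 / 2 : ℝ)) ≤ 3 := by
  rcases Nat.eq_zero_or_pos X with rfl | hX
  · simp
  have hsplit : ∑ n ∈ Icc 1 X, ((n : ℝ)) ^ (-(3 / 2 : ℝ)) =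
      1 + ∑ i ∈ Finset.Ico 1 X, (((i + 1 : ℕ) : ℝ)) ^ (-(3 / 2 : ℝ)) := by
    rw [Finset.sum_Ico_eq_sum_range, Finset.range_eq_Ico]
    have : Icc 1 X = insert 1 (Finset.Ico 2 (X + 1)) := by
      ext n; simp [Finset.mem_Icc, Finset.mem_Ico]; omega
    rw [this, Finset.sum_insert (by simp), Nat.cast_one, Real.one_rpow]
    congr 1
    have h2 : Finset.Ico 2 (X + 1) = (Finset.Ico 0 (X - 1)).image (fun i => 1 + i + 1) := by
      ext n
      simp only [Finset.mem_Ico, Finset.mem_image]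
      constructor
      · intro h; exact ⟨n - 2, by omega, by omega⟩
      · rintro ⟨i, hi, rfl⟩; omega
    rw [h2, Finset.sum_image (by intro a _ b _ h; simp only at h; omega)]
  rw [hsplit]
  have hanti : AntitoneOn (fun t : ℝ => t ^ (-(3 / 2 : ℝ))) (Set.Icc (1 : ℕ) (X : ℕ)) := by
    intro a ha b _ hab
    have ha0 : (0 : ℝ) < a := by simp at ha; linarith [ha.1]
    exact Real.rpow_le_rpow_of_nonpos ha0 hab (by norm_num)
  have hint := AntitoneOn.sum_le_integral_Ico hX hanti
  have hval : ∫ t in ((1 : ℕ) : ℝ)..(X : ℕ), t ^ (-(3 / 2 : ℝ)) ≤ 2 := by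
    rw [integral_rpow (Or.inr ⟨by norm_num, Set.notMem_uIcc_of_lt (by simp) (by exact_mod_cast hX)⟩)]
    norm_num
    have hX0 : (0 : ℝ) < X := by exact_mod_cast hX
    have : (0 : ℝ) ≤ (X : ℝ) ^ (-(1 / 2 : ℝ)) := Real.rpow_nonneg hX0.le _
    rw [div_le_iff_of_neg (by norm_num)]
    linarith
  linarith [hint.trans hval]

variable {A : SieveSequence} {D δ Δ : ℝ → ℝ}

/-- `∑_{p ≤ X} g(p) ≤ log log X + |c| + |K₉|/(log 2)^{10}` for `X ≥ 2`, from (1.9). [cite: FriedlanderIwaniecASP1998, (1.9)] -/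
theorem sum_primesLE_density_le {g : ArithmeticFunction ℝ} {c K₉ : ℝ}
    (h19 : ∀ y : ℝ, 2 ≤ y →
      |(∑ p ∈ Nat.primesLE ⌊y⌋₊, g p) - (Real.log (Real.log y) + c)| ≤ K₉ / Real.log y ^ 10)
    {X : ℕ} (hX : 2 ≤ X) :
    ∑ p ∈ Nat.primesLE X, g p ≤ Real.log (Real.log X) + |c| + |K₉| / Real.log 2 ^ 10 := by
  have h := h19 X (by exact_mod_cast hX)
  rw [Nat.floor_natCast] at h
  have h' := (abs_le.mp h).2
  have hl2 : 0 < Real.log 2 := Real.log_pos one_lt_two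
  have hlogX : Real.log 2 ≤ Real.log X := Real.log_le_log two_pos (by exact_mod_cast hX)
  have hK9 : K₉ / Real.log (X : ℝ) ^ 10 ≤ |K₉| / Real.log 2 ^ 10 := by
    calc K₉ / Real.log (X : ℝ) ^ 10 ≤ |K₉| / Real.log (X : ℝ) ^ 10 :=
          div_le_div_of_nonneg_right (le_abs_self _) (by positivity)
      _ ≤ |K₉| / Real.log 2 ^ 10 := by
          refine div_le_div_of_nonneg_left (abs_nonneg _) (by positivity) ?_
          gcongr
  linarith [le_abs_self c]

/-- **The `ν`-sum of the main terms** (FI §4: "`∑_ν |λ_ν| g(ν) τ(ν) σ_ν ≪ (log x)²`"): for `X ≥ 2`,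
`∑_{ν ≤ X sqfree} g(ν) τ(ν) σ_ν ≤ ∏_{p ≤ X} (1 + 2g(p)(1 + p^{-1/2})) ≤ e^{2C + 6K} (log X)²` under
(1.8) (`g(p) ≤ K/p`) and (1.9). [cite: FriedlanderIwaniecASP1998, §4 p. 1053] -/
theorem sum_squarefree_density_card_sigmaHalf_le {g : ArithmeticFunction ℝ} (hg : g.IsMultiplicative)
    {K c K₉ : ℝ} (hK : ∀ p : ℕ, p.Prime → 0 ≤ g p ∧ g p < 1 ∧ g p ≤ K / p)
    (h19 : ∀ y : ℝ, 2 ≤ y →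
      |(∑ p ∈ Nat.primesLE ⌊y⌋₊, g p) - (Real.log (Real.log y) + c)| ≤ K₉ / Real.log y ^ 10)
    {X : ℕ} (hX : 2 ≤ X) :
    ∑ ν ∈ (Icc 1 X).filter Squarefree, g ν * (ν.divisors.card : ℝ) * sigmaHalf ν ≤
      Real.exp (2 * (|c| + |K₉| / Real.log 2 ^ 10) + 6 * max K 0) * Real.log X ^ 2 := by
  have hg0 : ∀ p : ℕ, p.Prime → 0 ≤ g p := fun p hp => (hK p hp).1
  set K' := max K 0 with hK'
  have hgK' : ∀ p : ℕ, p.Prime → g p ≤ K' / p := fun p hp =>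
    (hK p hp).2.2.trans (div_le_div_of_nonneg_right (le_max_left _ _) (Nat.cast_nonneg _))
  -- summand as a product over prime factors
  have h1 : ∀ ν ∈ (Icc 1 X).filter Squarefree, g ν * (ν.divisors.card : ℝ) * sigmaHalf ν =
      ∏ p ∈ ν.primeFactors, 2 * g p * (1 + (Real.sqrt p)⁻¹) := by
    intro ν hν
    have hsq := (Finset.mem_filter.mp hν).2
    rw [Finset.prod_mul_distrib, Finset.prod_mul_distrib, Finset.prod_const, hg.prod_primeFactors hsq,
      card_divisors_of_squarefree hsq, sigmaHalf]
    push_cast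
    ring
  rw [Finset.sum_congr rfl h1]
  refine (sum_squarefree_prod_primeFactors_le (fun p hp => by
    have := hg0 p hp; positivity) X).trans ?_
  refine (prod_one_add_le_exp_sum _ fun p hp => by
    have := hg0 p (Nat.prime_of_mem_primesLE hp); positivity).trans ?_
  have hlogX : 0 < Real.log X := Real.log_pos (by exact_mod_cast hX)
  rw [show Real.log (X : ℝ) ^ 2 = Real.exp (2 * Real.log (Real.log X)) by
    rw [two_mul, Real.exp_add, Real.exp_log hlogX, sq], ← Real.exp_add]
  refine Real.exp_le_exp.mpr ?_
  -- split the exponent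
  have hsplit : ∑ p ∈ Nat.primesLE X, 2 * g p * (1 + (Real.sqrt p)⁻¹) =
      2 * ∑ p ∈ Nat.primesLE X, g p + 2 * ∑ p ∈ Nat.primesLE X, g p * (Real.sqrt p)⁻¹ := by
    rw [Finset.mul_sum, Finset.mul_sum, ← Finset.sum_add_distrib]
    refine Finset.sum_congr rfl fun p _ => by ring
  rw [hsplit]
  have hA := sum_primesLE_density_le h19 hX
  have hB : ∑ p ∈ Nat.primesLE X, g p * (Real.sqrt p)⁻¹ ≤ 3 * K' := by
    calc ∑ p ∈ Nat.primesLE X, g p * (Real.sqrt p)⁻¹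
        ≤ ∑ p ∈ Nat.primesLE X, K' * ((p : ℝ)) ^ (-(3 / 2 : ℝ)) := by
          refine Finset.sum_le_sum fun p hp => ?_
          have hpp := Nat.prime_of_mem_primesLE hp
          have hp0 : (0 : ℝ) < p := by exact_mod_cast hpp.pos
          have hsq : (Real.sqrt p)⁻¹ = (p : ℝ) ^ (-(1 / 2 : ℝ)) := by
            rw [Real.sqrt_eq_rpow, ← Real.rpow_neg hp0.le]
          have h32 : K' * (p : ℝ) ^ (-(3 / 2 : ℝ)) = K' / p * (p : ℝ) ^ (-(1 / 2 : ℝ)) := by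
            rw [show (-(3 / 2 : ℝ)) = (-1) + (-(1 / 2)) by norm_num, Real.rpow_add hp0,
              Real.rpow_neg_one]
            ring
          rw [hsq, h32]
          exact mul_le_mul_of_nonneg_right (hgK' p hpp) (Real.rpow_nonneg hp0.le _)
      _ = K' * ∑ p ∈ Nat.primesLE X, ((p : ℝ)) ^ (-(3 / 2 : ℝ)) := by rw [Finset.mul_sum]
      _ ≤ K' * ∑ n ∈ Icc 1 X, ((n : ℝ)) ^ (-(3 / 2 : ℝ)) := by
          refine mul_le_mul_of_nonneg_left ?_ (le_max_right _ _)
          refine Finset.sum_le_sum_of_subset_of_nonneg (fun p hp => ?_) fun n _ _ => by positivity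
          obtain ⟨hpX, hpp⟩ := Nat.mem_primesLE.mp hp
          exact Finset.mem_Icc.mpr ⟨hpp.pos, hpX⟩
      _ ≤ K' * 3 := mul_le_mul_of_nonneg_left (sum_Icc_rpow_neg_three_halves_le X) (le_max_right _ _)
      _ = 3 * K' := by ring
  nlinarith [hA, hB, le_max_right K 0]

/-- **The `c`-sum of the main terms** (FI §5: "`∑^♭_{c ≤ z} Λ(c) g(c/(ν, c))`", bounded using (1.8)
and Mertens: `≤ K'(log z + log 4) + log ν`): for squarefree `ν` and `z ≥ 1`,
`∑_{c ≤ z prime} log c · g(c/(c, ν)) ≤ K' (log z + log 4) + log ν`, `K' = max K 0`.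
[cite: FriedlanderIwaniecASP1998, §5 (5.1)] -/
theorem sum_primes_log_mul_density_div_gcd_le {g : ArithmeticFunction ℝ} (hg : g.IsMultiplicative)
    {K : ℝ} (hK : ∀ p : ℕ, p.Prime → 0 ≤ g p ∧ g p < 1 ∧ g p ≤ K / p) {ν : ℕ} (hν : Squarefree ν)
    {z : ℝ} (hz : 1 ≤ z) :
    ∑ c ∈ (Icc 1 ⌊z⌋₊).filter Nat.Prime, Real.log c * g (c / Nat.gcd c ν) ≤
      max K 0 * (Real.log z + Real.log 4) + Real.log ν := by
  classical
  set K' := max K 0 with hK'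
  have hgK' : ∀ p : ℕ, p.Prime → g p ≤ K' / p := fun p hp =>
    (hK p hp).2.2.trans (div_le_div_of_nonneg_right (le_max_left _ _) (Nat.cast_nonneg _))
  have hν0 : ν ≠ 0 := hν.ne_zero
  -- split according to `c ∣ ν`
  have hterm : ∀ c ∈ (Icc 1 ⌊z⌋₊).filter Nat.Prime, Real.log c * g (c / Nat.gcd c ν) ≤
      K' * (Real.log c / c) + (if c ∣ ν then Real.log c else 0) := by
    intro c hc
    have hcp := (Finset.mem_filter.mp hc).2
    have hc0 : (0 : ℝ) < c := by exact_mod_cast hcp.pos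
    have hlogc : 0 ≤ Real.log c := Real.log_nonneg (by exact_mod_cast hcp.one_lt.le)
    rw [Nat.Prime.div_gcd_eq hcp ν]
    split_ifs with hcν
    · rw [hg.map_one, mul_one]
      have : 0 ≤ K' * (Real.log c / c) := mul_nonneg (le_max_right _ _) (div_nonneg hlogc hc0.le)
      linarith
    · rw [add_zero]
      calc Real.log c * g c ≤ Real.log c * (K' / c) := mul_le_mul_of_nonneg_left (hgK' c hcp) hlogc
        _ = K' * (Real.log c / c) := by ring
  refine (Finset.sum_le_sum hterm).trans ?_
  rw [Finset.sum_add_distrib, ← Finset.mul_sum, ← Finset.sum_filter]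
  have hprimes : (Icc 1 ⌊z⌋₊).filter Nat.Prime = Nat.primesLE ⌊z⌋₊ := by
    ext c
    simp only [Finset.mem_filter, Finset.mem_Icc, Nat.mem_primesLE]
    constructor
    · rintro ⟨⟨-, h2⟩, hp⟩; exact ⟨h2, hp⟩
    · rintro ⟨h2, hp⟩; exact ⟨⟨hp.pos, h2⟩, hp⟩
  have h1 : ∑ c ∈ (Icc 1 ⌊z⌋₊).filter Nat.Prime, Real.log c / c ≤ Real.log z + Real.log 4 := by
    rw [hprimes]
    refine (LFunctions.MertensBound.sum_log_div_prime_le ⌊z⌋₊).trans ?_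
    rcases Nat.eq_zero_or_pos ⌊z⌋₊ with h0 | h0
    · rw [h0]; simp; exact Real.log_nonneg hz
    · have : Real.log (⌊z⌋₊ : ℝ) ≤ Real.log z :=
        Real.log_le_log (by exact_mod_cast h0) (Nat.floor_le (by linarith))
      linarith
  have h2 : ∑ c ∈ ((Icc 1 ⌊z⌋₊).filter Nat.Prime).filter (fun c => c ∣ ν), Real.log c ≤ Real.log ν := by
    calc ∑ c ∈ ((Icc 1 ⌊z⌋₊).filter Nat.Prime).filter (fun c => c ∣ ν), Real.log c
        ≤ ∑ c ∈ ν.primeFactors, Real.log c := by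
          refine Finset.sum_le_sum_of_subset_of_nonneg (fun c hc => ?_) fun c hc _ =>
            Real.log_nonneg (by exact_mod_cast (Nat.prime_of_mem_primeFactors hc).one_lt.le)
          obtain ⟨hc1, hcν⟩ := Finset.mem_filter.mp hc
          exact Nat.mem_primeFactors.mpr ⟨(Finset.mem_filter.mp hc1).2, hcν, hν0⟩
      _ = Real.log ν := by
          rw [← Real.log_prod (fun p hp => by exact_mod_cast (Nat.prime_of_mem_primeFactors hp).ne_zero),
            ← Nat.cast_prod, Nat.prod_primeFactors_of_squarefree hν]
  have hK'0 : 0 ≤ K' := le_max_right _ _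
  nlinarith [h1, h2]


/-! ### `T(x; y, z)` unfolded: main terms and remainder terms -/

section Unfold

variable {A : SieveSequence} {D δ Δ : ℝ → ℝ}

/-- `A_d(x) = g(d) A(x) + r_d(x)` (FI (1.7), the definition of `r_d`). [cite: FriedlanderIwaniecASP1998, (1.7)] -/
theorem SieveSequence.congrSum_eq_density_mul_size_add_remainder (A : SieveSequence) (d : ℕ) (x : ℝ) :
    A.congrSum d x = A.density d * A.size x + A.remainder d x := by
  rw [SieveSequence.remainder]; ring

/-- Under (1.16), `A_d(x) = 0` unless `d` is squarefree. [cite: FriedlanderIwaniecASP1998, (1.16)] -/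
theorem SieveSequence.FIAsymptoticSieveHypotheses.congrSum_eq_zero_of_not_squarefree
    (h : A.FIAsymptoticSieveHypotheses D δ Δ) {d : ℕ} (hd : ¬Squarefree d) (x : ℝ) :
    A.congrSum d x = 0 := by
  rw [SieveSequence.congrSum]
  refine Finset.sum_eq_zero fun n hn => ?_
  obtain ⟨-, hdn⟩ := Finset.mem_filter.mp hn
  exact h.a_eq_zero fun hn' => hd (hn'.squarefree_of_dvd hdn)

/-- Restricting a sum against `f(b ≤ y)` over `b ≤ x` to `b ≤ ⌊y⌋` (`0 ≤ y ≤ x`). [folklore] -/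
theorem sum_Icc_truncLE_mul (f : ArithmeticFunction ℝ) (F : ℕ → ℝ) {y x : ℝ} (hy : 0 ≤ y)
    (hyx : y ≤ x) :
    ∑ b ∈ Icc 1 ⌊x⌋₊, truncLE f y b * F b = ∑ b ∈ Icc 1 ⌊y⌋₊, f b * F b := by
  have hsub : Icc 1 ⌊y⌋₊ ⊆ Icc 1 ⌊x⌋₊ := Finset.Icc_subset_Icc_right (Nat.floor_le_floor hyx)
  calc ∑ b ∈ Icc 1 ⌊x⌋₊, truncLE f y b * F b = ∑ b ∈ Icc 1 ⌊y⌋₊, truncLE f y b * F b := by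
        refine (Finset.sum_subset hsub fun b hbx hby => ?_).symm
        have hby' : ¬(b : ℝ) ≤ y := fun h' =>
          hby (Finset.mem_Icc.mpr ⟨(Finset.mem_Icc.mp hbx).1, Nat.le_floor h'⟩)
        rw [truncLE_apply, if_neg hby', zero_mul]
    _ = ∑ b ∈ Icc 1 ⌊y⌋₊, f b * F b := by
        refine Finset.sum_congr rfl fun b hb => ?_
        have hby : (b : ℝ) ≤ y := (Nat.le_floor_iff hy).mp (Finset.mem_Icc.mp hb).2
        rw [truncLE_apply, if_pos hby]

/-- Restricting a `λ`-weighted sum over `ν ≤ x` to `ν ≤ ⌊L⌋`, `L` the level (`λ_ν = 0` for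
`ν > L`). [folklore] -/
theorem IsUpperSieveWeights.sum_Icc_eq_sum_Icc_floor {P L : ℝ} {lam : ℕ → ℤ}
    (hw : IsUpperSieveWeights P L lam) (G : ℕ → ℝ) {x : ℝ} (hL : 0 ≤ L) (hLx : L ≤ x) :
    ∑ ν ∈ Icc 1 ⌊x⌋₊, (lam ν : ℝ) * G ν = ∑ ν ∈ Icc 1 ⌊L⌋₊, (lam ν : ℝ) * G ν := by
  have hsub : Icc 1 ⌊L⌋₊ ⊆ Icc 1 ⌊x⌋₊ := Finset.Icc_subset_Icc_right (Nat.floor_le_floor hLx)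
  refine (Finset.sum_subset hsub fun ν hνx hνL => ?_).symm
  have hlt : L < ν := by
    have : ⌊L⌋₊ < ν := by
      by_contra hcon
      push Not at hcon
      exact hνL (Finset.mem_Icc.mpr ⟨(Finset.mem_Icc.mp hνx).1, hcon⟩)
    exact (Nat.floor_lt hL).mp this
  rw [hw.eq_zero_of_lt hlt, Int.cast_zero, zero_mul]

/-- **`T(x; y, z)` unfolded** (FI §5, first display, with (4.3)):
`T(x; y, z) = ∑_{b ≤ y} ∑_{c ≤ z} ∑_{ν ≤ L} μ(b) Λ(c) λ_ν A_{[bc, ν]}(x)` for weights of level `L`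
and `y, z, L ≤ x`. [cite: FriedlanderIwaniecASP1998, §5] -/
theorem SieveSequence.fiTyz_eq_sum_box (A : SieveSequence) {P L : ℝ} {lam : ℕ → ℤ}
    (hw : IsUpperSieveWeights P L lam) {x y z : ℝ} (hy : 0 ≤ y) (hyx : y ≤ x) (hz : 0 ≤ z)
    (hzx : z ≤ x) (hL : 0 ≤ L) (hLx : L ≤ x) :
    A.fiTyz lam x y z = ∑ b ∈ Icc 1 ⌊y⌋₊, ∑ c ∈ Icc 1 ⌊z⌋₊, ∑ ν ∈ Icc 1 ⌊L⌋₊,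
      (μ b : ℝ) * Λ c * (lam ν : ℝ) * A.congrSum (Nat.lcm (b * c) ν) x := by
  rw [SieveSequence.fiTyz, SieveSequence.rhoSum_mul_mul_zeta]
  have hc : ∀ b : ℕ, ∑ c ∈ Icc 1 ⌊x⌋₊, truncLE (μ : ArithmeticFunction ℝ) y b * truncLE Λ z c *
        (∑ n ∈ (Icc 1 ⌊x⌋₊).filter (b * c ∣ ·), A.a n * (sieveRho lam n : ℝ)) =
      truncLE (μ : ArithmeticFunction ℝ) y b * ∑ c ∈ Icc 1 ⌊z⌋₊, Λ c *
        (∑ n ∈ (Icc 1 ⌊x⌋₊).filter (b * c ∣ ·), A.a n * (sieveRho lam n : ℝ)) := by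
    intro b
    rw [← sum_Icc_truncLE_mul Λ
      (fun c => (∑ n ∈ (Icc 1 ⌊x⌋₊).filter (b * c ∣ ·), A.a n * (sieveRho lam n : ℝ))) hz hzx,
      Finset.mul_sum]
    exact Finset.sum_congr rfl fun c _ => by ring
  rw [Finset.sum_congr rfl fun b _ => hc b,
    sum_Icc_truncLE_mul (μ : ArithmeticFunction ℝ)
      (fun b => ∑ c ∈ Icc 1 ⌊z⌋₊, Λ c *
        (∑ n ∈ (Icc 1 ⌊x⌋₊).filter (b * c ∣ ·), A.a n * (sieveRho lam n : ℝ))) hy hyx]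
  refine Finset.sum_congr rfl fun b _ => ?_
  rw [ArithmeticFunction.intCoe_apply, Finset.mul_sum]
  refine Finset.sum_congr rfl fun c _ => ?_
  rw [SieveSequence.sum_a_mul_sieveRho_eq_sum_congrSum,
    hw.sum_Icc_eq_sum_Icc_floor (fun ν => A.congrSum (Nat.lcm (b * c) ν) x) hL hLx, Finset.mul_sum,
    Finset.mul_sum]
  exact Finset.sum_congr rfl fun ν _ => by ring

/-- **The summands of the main term** (FI §5: only squarefree `[bc, ν]` occur, `c` is then a prime
not dividing `b`, and `g([bc, ν]) = g(ν) g(b/(ν, b)) g(c/(ν, c))`): pointwise, for `b, ν ≥ 1`,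
`[ [bc,ν] sqfree ] μ(b) Λ(c) λ_ν g([bc, ν])
  = [ν sqfree ∧ c prime ∧ b sqfree ∧ (b, c) = 1] λ_ν g(ν) · (log c · g(c/(c, ν))) · (μ(b) g(b/(b, ν)))`.
[cite: FriedlanderIwaniecASP1998, §5] -/
theorem fi_mainTerm_pointwise {g : ArithmeticFunction ℝ} (hg : g.IsMultiplicative) (lamν μb : ℝ)
    {b c ν : ℕ} (hν : ν ≠ 0) :
    (if Squarefree (Nat.lcm (b * c) ν) then μb * Λ c * lamν * g (Nat.lcm (b * c) ν) else 0) =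
      if Squarefree ν ∧ c.Prime ∧ Squarefree b ∧ b.Coprime c then
        lamν * g ν * (Real.log c * g (c / Nat.gcd c ν)) * (μb * g (b / Nat.gcd b ν)) else 0 := by
  by_cases hc : c.Prime
  · have hiff : Squarefree (Nat.lcm (b * c) ν) ↔ Squarefree ν ∧ Squarefree b ∧ b.Coprime c := by
      constructor
      · intro h
        have hbc := Squarefree.of_lcm_left h
        rw [Nat.squarefree_mul_iff] at hbc
        exact ⟨Squarefree.of_lcm_right h, hbc.2.1, hbc.1⟩
      · rintro ⟨hνs, hbs, hcop⟩
        have hbc : Squarefree (b * c) := Nat.squarefree_mul_iff.mpr ⟨hcop, hbs, hc.prime.squarefree⟩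
        exact (squarefree_lcm_iff_of_squarefree hbc hν).mpr hνs
    by_cases hcond : Squarefree ν ∧ Squarefree b ∧ b.Coprime c
    · obtain ⟨hνs, hbs, hcop⟩ := hcond
      have hbc : Squarefree (b * c) := Nat.squarefree_mul_iff.mpr ⟨hcop, hbs, hc.prime.squarefree⟩
      rw [if_pos (hiff.mpr ⟨hνs, hbs, hcop⟩),
        if_pos (show Squarefree ν ∧ c.Prime ∧ Squarefree b ∧ b.Coprime c from ⟨hνs, hc, hbs, hcop⟩),
        ArithmeticFunction.vonMangoldt_apply_prime hc,
        ArithmeticFunction.IsMultiplicative.map_lcm_of_squarefree hg hbc hν,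
        (mul_div_gcd_eq_of_coprime hcop ν).1,
        hg.map_mul_of_coprime (mul_div_gcd_eq_of_coprime hcop ν).2]
      ring
    · rw [if_neg (show ¬Squarefree (Nat.lcm (b * c) ν) from fun h => hcond (hiff.mp h)),
        if_neg (show ¬(Squarefree ν ∧ c.Prime ∧ Squarefree b ∧ b.Coprime c) from
          fun h => hcond ⟨h.1, h.2.2⟩)]
  · rw [if_neg (show ¬(Squarefree ν ∧ c.Prime ∧ Squarefree b ∧ b.Coprime c) from
      fun h => hc h.2.1)]
    split_ifs with hsq
    · -- `Λ(c) = 0`: otherwise `c` is a prime power which is squarefree, hence prime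
      suffices hΛ : Λ c = 0 by rw [hΛ]; ring
      rw [ArithmeticFunction.vonMangoldt_eq_zero_iff]
      rintro ⟨p, k, hp, hk, rfl⟩
      have hcs : Squarefree (p ^ k) := (Squarefree.of_lcm_left hsq).of_mul_right
      rcases Nat.lt_or_ge 1 k with hk1 | hk1
      · have hdvd : p * p ∣ p ^ k := by
          rw [← sq]
          exact pow_dvd_pow p hk1
        exact hp.not_unit (hcs p hdvd)
      · have hk' : k = 1 := le_antisymm hk1 hk
        subst hk'
        exact hc (by rw [pow_one]; exact Nat.prime_iff.mpr hp)
    · rfl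

/-- **`T(x; y, z)` = `A(x)` · main terms + remainder terms** (FI §5: "We insert the approximation
(1.7) for `A_{[ν, bc]}(x)`"; only squarefree moduli occur by (1.16)).
[cite: FriedlanderIwaniecASP1998, §5] -/
theorem SieveSequence.FIAsymptoticSieveHypotheses.fiTyz_eq_main_add_rem
    (h : A.FIAsymptoticSieveHypotheses D δ Δ) {P L : ℝ} {lam : ℕ → ℤ}
    (hw : IsUpperSieveWeights P L lam) {x y z : ℝ} (hy : 0 ≤ y) (hyx : y ≤ x) (hz : 0 ≤ z)
    (hzx : z ≤ x) (hL : 0 ≤ L) (hLx : L ≤ x) :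
    A.fiTyz lam x y z =
      A.size x * (∑ b ∈ Icc 1 ⌊y⌋₊, ∑ c ∈ Icc 1 ⌊z⌋₊, ∑ ν ∈ Icc 1 ⌊L⌋₊,
        if Squarefree (Nat.lcm (b * c) ν) then
          (μ b : ℝ) * Λ c * (lam ν : ℝ) * A.density (Nat.lcm (b * c) ν) else 0)
      + ∑ b ∈ Icc 1 ⌊y⌋₊, ∑ c ∈ Icc 1 ⌊z⌋₊, ∑ ν ∈ Icc 1 ⌊L⌋₊,
        if Squarefree (Nat.lcm (b * c) ν) then
          (μ b : ℝ) * Λ c * (lam ν : ℝ) * A.remainder (Nat.lcm (b * c) ν) x else 0 := by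
  rw [A.fiTyz_eq_sum_box hw hy hyx hz hzx hL hLx, Finset.mul_sum, ← Finset.sum_add_distrib]
  refine Finset.sum_congr rfl fun b _ => ?_
  rw [Finset.mul_sum, ← Finset.sum_add_distrib]
  refine Finset.sum_congr rfl fun c _ => ?_
  rw [Finset.mul_sum, ← Finset.sum_add_distrib]
  refine Finset.sum_congr rfl fun ν _ => ?_
  split_ifs with hsq
  · rw [SieveSequence.congrSum_eq_density_mul_size_add_remainder]; ring
  · rw [h.congrSum_eq_zero_of_not_squarefree hsq]; ring

/-- **The remainder terms** (FI §5): with `|μ(b)|, |λ_ν| ≤ 1` and the box `⌊y⌋⌊z⌋⌊L⌋ ≤ D(x) ≤ x`,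
`|∑_{b,c,ν} [sqfree] μ(b)Λ(c)λ_ν r_{[bc,ν]}(x)| ≤ log x · ∑_{d ≤ D(x) sqfree} τ₅(d)|r_d(x)|`
(`sum_box_vonMangoldt_abs_remainder_le`). [cite: FriedlanderIwaniecASP1998, §5 (5.1)] -/
theorem SieveSequence.abs_fiTyz_remTerms_le (A : SieveSequence) {lam : ℕ → ℤ}
    (hlam : ∀ ν, |lam ν| ≤ 1) {D : ℝ → ℝ} {x : ℝ} {By Cz NL : ℕ}
    (hbox : ((By * Cz * NL : ℕ) : ℝ) ≤ D x) (hDx : D x ≤ x) :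
    |∑ b ∈ Icc 1 By, ∑ c ∈ Icc 1 Cz, ∑ ν ∈ Icc 1 NL,
        if Squarefree (Nat.lcm (b * c) ν) then
          (μ b : ℝ) * Λ c * (lam ν : ℝ) * A.remainder (Nat.lcm (b * c) ν) x else 0| ≤
      Real.log x * ∑ d ∈ (Icc 1 ⌊D x⌋₊).filter Squarefree,
        (divisorCountK 5 d : ℝ) * |A.remainder d x| := by
  refine le_trans ?_ (sum_box_vonMangoldt_abs_remainder_le A hbox hDx)
  rw [Finset.sum_product, Finset.sum_product]
  refine (Finset.abs_sum_le_sum_abs _ _).trans (Finset.sum_le_sum fun b _ => ?_)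
  refine (Finset.abs_sum_le_sum_abs _ _).trans (Finset.sum_le_sum fun c _ => ?_)
  refine (Finset.abs_sum_le_sum_abs _ _).trans (Finset.sum_le_sum fun ν _ => ?_)
  dsimp only
  split_ifs with hsq
  · rw [abs_mul, abs_mul, abs_mul, abs_of_nonneg ArithmeticFunction.vonMangoldt_nonneg]
    have h1 : |(μ b : ℝ)| ≤ 1 := by exact_mod_cast ArithmeticFunction.abs_moebius_le_one
    have h2 : |(lam ν : ℝ)| ≤ 1 := by exact_mod_cast hlam ν
    have hΛ : 0 ≤ Λ c := ArithmeticFunction.vonMangoldt_nonneg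
    have hr : 0 ≤ |A.remainder (Nat.lcm (b * c) ν) x| := abs_nonneg _
    calc |(μ b : ℝ)| * Λ c * |(lam ν : ℝ)| * |A.remainder (Nat.lcm (b * c) ν) x|
        ≤ 1 * Λ c * 1 * |A.remainder (Nat.lcm (b * c) ν) x| := by gcongr
      _ = Λ c * |A.remainder (Nat.lcm (b * c) ν) x| := by ring
  · simp

/-- **The main terms rearranged** (FI §5, second display:
`∑_b μ(b) ∑^♭_c Λ(c) g(bc/(ν,bc)) = ∑_b μ(b) g(b/(ν,b)) ∑^♭_{c ∤ b} Λ(c) g(c/(ν,c))`, summed against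
`λ_ν g(ν)`): the triple sum of `fiTyz_eq_main_add_rem` equals
`∑_{ν sqfree} λ_ν g(ν) ∑_{c prime} log c · g(c/(c,ν)) ∑_{b sqfree, (b,c)=1} μ(b) g(b/(b,ν))`.
[cite: FriedlanderIwaniecASP1998, §5] -/
theorem fi_mainTerms_eq {g : ArithmeticFunction ℝ} (hg : g.IsMultiplicative) (lam : ℕ → ℤ)
    (By Cz NL : ℕ) :
    ∑ b ∈ Icc 1 By, ∑ c ∈ Icc 1 Cz, ∑ ν ∈ Icc 1 NL,
        (if Squarefree (Nat.lcm (b * c) ν) then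
          (μ b : ℝ) * Λ c * (lam ν : ℝ) * g (Nat.lcm (b * c) ν) else 0) =
      ∑ ν ∈ (Icc 1 NL).filter Squarefree, (lam ν : ℝ) * g ν *
        ∑ c ∈ (Icc 1 Cz).filter Nat.Prime, Real.log c * g (c / Nat.gcd c ν) *
          ∑ b ∈ (Icc 1 By).filter (fun b => Squarefree b ∧ b.Coprime c),
            (μ b : ℝ) * g (b / Nat.gcd b ν) := by
  calc ∑ b ∈ Icc 1 By, ∑ c ∈ Icc 1 Cz, ∑ ν ∈ Icc 1 NL,
        (if Squarefree (Nat.lcm (b * c) ν) then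
          (μ b : ℝ) * Λ c * (lam ν : ℝ) * g (Nat.lcm (b * c) ν) else 0)
      = ∑ c ∈ Icc 1 Cz, ∑ ν ∈ Icc 1 NL, ∑ b ∈ Icc 1 By,
        (if Squarefree (Nat.lcm (b * c) ν) then
          (μ b : ℝ) * Λ c * (lam ν : ℝ) * g (Nat.lcm (b * c) ν) else 0) := by
        rw [Finset.sum_comm]
        exact Finset.sum_congr rfl fun c _ => Finset.sum_comm
    _ = ∑ ν ∈ Icc 1 NL, ∑ c ∈ Icc 1 Cz, ∑ b ∈ Icc 1 By,
        (if Squarefree (Nat.lcm (b * c) ν) then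
          (μ b : ℝ) * Λ c * (lam ν : ℝ) * g (Nat.lcm (b * c) ν) else 0) := Finset.sum_comm
    _ = ∑ ν ∈ Icc 1 NL, ∑ c ∈ Icc 1 Cz, ∑ b ∈ Icc 1 By,
        (if Squarefree ν ∧ c.Prime ∧ Squarefree b ∧ b.Coprime c then
          (lam ν : ℝ) * g ν * (Real.log c * g (c / Nat.gcd c ν)) * ((μ b : ℝ) * g (b / Nat.gcd b ν))
          else 0) := by
        refine Finset.sum_congr rfl fun ν hν => Finset.sum_congr rfl fun c _ =>
          Finset.sum_congr rfl fun b _ => ?_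
        have hν0 : ν ≠ 0 := by have := (Finset.mem_Icc.mp hν).1; omega
        exact fi_mainTerm_pointwise hg (lam ν : ℝ) (μ b : ℝ) hν0
    _ = _ := by
        rw [Finset.sum_filter]
        refine Finset.sum_congr rfl fun ν _ => ?_
        split_ifs with hνs
        · rw [Finset.sum_filter, Finset.mul_sum]
          refine Finset.sum_congr rfl fun c _ => ?_
          split_ifs with hc
          · rw [Finset.sum_filter, Finset.mul_sum, Finset.mul_sum]
            refine Finset.sum_congr rfl fun b _ => ?_
            split_ifs with h1 h2 h2
            · ring
            · exact absurd h1.2.2 h2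
            · exact absurd (show Squarefree ν ∧ c.Prime ∧ Squarefree b ∧ b.Coprime c from
                ⟨hνs, hc, h2⟩) h1
            · ring
          · rw [mul_zero]
            exact Finset.sum_eq_zero fun b _ =>
              if_neg (show ¬(Squarefree ν ∧ c.Prime ∧ Squarefree b ∧ b.Coprime c) from
                fun h => hc h.2.1)
        · exact Finset.sum_eq_zero fun c _ => Finset.sum_eq_zero fun b _ =>
            if_neg (show ¬(Squarefree ν ∧ c.Prime ∧ Squarefree b ∧ b.Coprime c) from
              fun h => hνs h.1)

end Unfold

/-! ### Bounding the main terms -/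

/-- `σ` is submultiplicative: `σ_{mn} ≤ σ_m σ_n`. [folklore] -/
theorem sigmaHalf_mul_le (m n : ℕ) : sigmaHalf (m * n) ≤ sigmaHalf m * sigmaHalf n := by
  classical
  rcases eq_or_ne m 0 with rfl | hm
  · rw [zero_mul, sigmaHalf_zero, one_mul]; exact one_le_sigmaHalf n
  rcases eq_or_ne n 0 with rfl | hn
  · rw [mul_zero, sigmaHalf_zero, mul_one]; exact one_le_sigmaHalf m
  simp only [sigmaHalf]
  rw [Nat.primeFactors_mul hm hn, ← Finset.prod_union_inter]
  refine le_mul_of_one_le_right (Finset.prod_nonneg fun p _ => by positivity) ?_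
  exact Finset.one_le_prod fun p _ => by
    simp only [le_add_iff_nonneg_right, inv_nonneg]
    exact Real.sqrt_nonneg _

/-- `σ_p ≤ 2` for a prime `p`. [folklore] -/
theorem sigmaHalf_prime_le_two {p : ℕ} (hp : p.Prime) : sigmaHalf p ≤ 2 := by
  have := sigmaHalf_le_two_pow p
  rwa [ArithmeticFunction.cardDistinctFactors_apply_prime hp, pow_one] at this

/-- A multiplicative `g` with `g(p) ≥ 0` is nonnegative on squarefree numbers. [folklore] -/
theorem ArithmeticFunction.IsMultiplicative.nonneg_of_squarefree {g : ArithmeticFunction ℝ}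
    (hg : g.IsMultiplicative) (h0 : ∀ p : ℕ, p.Prime → 0 ≤ g p) {n : ℕ} (hn : Squarefree n) :
    0 ≤ g n := by
  rw [← hg.prod_primeFactors hn]
  exact Finset.prod_nonneg fun p hp => h0 p (Nat.prime_of_mem_primeFactors hp)

/-- **The main terms of `T(x; y, z)` are `≪ (log x)^{-3}`** (FI §5: "by (2.4), (1.8) this is
`≪ τ(ν) σ_ν (log y)^{-6} (log νz)`. Summing over `ν`, as with `T₁(x; y)` we get a contribution
`≪ A(x)(log x)^{-3}`"). Explicitly, for `|λ_ν| ≤ 1`, `L ≥ 2`, `y ≥ 2L`, `z ≥ 1`, with the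
constants of (1.8) (`K`), (1.9) (`c₉, K₉`) and (2.4) (`K₂₄`):
`|∑_{ν ≤ L sqfree} λ_ν g(ν) ∑_{c ≤ z prime} log c g(c/(c,ν)) ∑_{b ≤ y sqfree, (b,c)=1} μ(b) g(b/(b,ν))|
  ≤ e^{2(|c₉| + |K₉|(log 2)^{-10}) + 6K'} (log ⌊L⌋)² · 2|K₂₄| (log(y/L))^{-6} · (K'+1)(log z + log 4 + log L)`,
`K' = max K 0`. [cite: FriedlanderIwaniecASP1998, §5 (5.1)] -/
theorem abs_fi_mainTerms_le {g : ArithmeticFunction ℝ} (hg : g.IsMultiplicative)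
    {K c₉ K₉ K₂₄ : ℝ} (hK : ∀ p : ℕ, p.Prime → 0 ≤ g p ∧ g p < 1 ∧ g p ≤ K / p)
    (h19 : ∀ y : ℝ, 2 ≤ y →
      |(∑ p ∈ Nat.primesLE ⌊y⌋₊, g p) - (Real.log (Real.log y) + c₉)| ≤ K₉ / Real.log y ^ 10)
    (h24 : ∀ ν : ℕ, 1 ≤ ν → ∀ y : ℝ, 2 ≤ y →
      |∑ d ∈ (Icc 1 ⌊y⌋₊).filter (fun d : ℕ => d.Coprime ν), (μ d : ℝ) * g d| ≤
        K₂₄ * sigmaHalf ν / Real.log y ^ 6)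
    {lam : ℕ → ℤ} (hlam : ∀ ν, |lam ν| ≤ 1) {L y z : ℝ} (hL : 2 ≤ L) (hyL : 2 * L ≤ y)
    (hz : 1 ≤ z) :
    |∑ ν ∈ (Icc 1 ⌊L⌋₊).filter Squarefree, (lam ν : ℝ) * g ν *
        ∑ c ∈ (Icc 1 ⌊z⌋₊).filter Nat.Prime, Real.log c * g (c / Nat.gcd c ν) *
          ∑ b ∈ (Icc 1 ⌊y⌋₊).filter (fun b => Squarefree b ∧ b.Coprime c),
            (μ b : ℝ) * g (b / Nat.gcd b ν)| ≤
      Real.exp (2 * (|c₉| + |K₉| / Real.log 2 ^ 10) + 6 * max K 0) * Real.log ⌊L⌋₊ ^ 2 *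
        (2 * |K₂₄| / Real.log (y / L) ^ 6 * ((max K 0 + 1) * (Real.log z + Real.log 4 + Real.log L))) := by
  classical
  set K' := max K 0 with hK'
  set M₀ := 2 * |K₂₄| / Real.log (y / L) ^ 6 with hM₀
  set W := Real.log z + Real.log 4 + Real.log L with hW
  have hK'0 : 0 ≤ K' := le_max_right _ _
  have hL0 : 0 < L := by linarith
  have hyL' : 2 ≤ y / L := by rw [le_div_iff₀ hL0]; linarith
  have hlogyL : 0 < Real.log (y / L) := Real.log_pos (by linarith)
  have hM₀0 : 0 ≤ M₀ := div_nonneg (by positivity) (pow_nonneg hlogyL.le _)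
  have hlogL : 0 ≤ Real.log L := Real.log_nonneg (by linarith)
  have hlogz : 0 ≤ Real.log z := Real.log_nonneg hz
  have hlog4 : 0 ≤ Real.log 4 := Real.log_nonneg (by norm_num)
  have hW0 : 0 ≤ W := by positivity
  have hg0 : ∀ p : ℕ, p.Prime → 0 ≤ g p := fun p hp => (hK p hp).1
  have hLfloor : 2 ≤ ⌊L⌋₊ := Nat.le_floor (by exact_mod_cast hL)
  -- the bound for each squarefree `ν ≤ L`
  have hν_bound : ∀ ν ∈ (Icc 1 ⌊L⌋₊).filter Squarefree,
      |(lam ν : ℝ) * g ν *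
        ∑ c ∈ (Icc 1 ⌊z⌋₊).filter Nat.Prime, Real.log c * g (c / Nat.gcd c ν) *
          ∑ b ∈ (Icc 1 ⌊y⌋₊).filter (fun b => Squarefree b ∧ b.Coprime c),
            (μ b : ℝ) * g (b / Nat.gcd b ν)| ≤
      g ν * (ν.divisors.card : ℝ) * sigmaHalf ν * (M₀ * ((K' + 1) * W)) := by
    intro ν hν
    obtain ⟨hν1, hνs⟩ := Finset.mem_filter.mp hν
    obtain ⟨hν1', hνL⟩ := Finset.mem_Icc.mp hν1
    have hν0 : ν ≠ 0 := by omega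
    have hνL' : (ν : ℝ) ≤ L := (Nat.cast_le.mpr hνL).trans (Nat.floor_le hL0.le)
    have hν1r : (1 : ℝ) ≤ ν := by exact_mod_cast hν1'
    have hgν : 0 ≤ g ν := ArithmeticFunction.IsMultiplicative.nonneg_of_squarefree hg hg0 hνs
    have hσ : 0 ≤ sigmaHalf ν := zero_le_one.trans (one_le_sigmaHalf ν)
    have hτ : 0 ≤ (ν.divisors.card : ℝ) := Nat.cast_nonneg _
    -- inner `b`-sums, by (2.4)
    have hb : ∀ c ∈ (Icc 1 ⌊z⌋₊).filter Nat.Prime,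
        |∑ b ∈ (Icc 1 ⌊y⌋₊).filter (fun b => Squarefree b ∧ b.Coprime c),
            (μ b : ℝ) * g (b / Nat.gcd b ν)| ≤ (ν.divisors.card : ℝ) * sigmaHalf ν * M₀ := by
      intro c hc
      obtain ⟨hc1, hcp⟩ := Finset.mem_filter.mp hc
      have hc1' : 1 ≤ c := (Finset.mem_Icc.mp hc1).1
      have h2ν : 2 * (ν : ℝ) ≤ y := by linarith
      refine (abs_sum_moebius_density_div_gcd_le h24 hνs hc1' h2ν).trans ?_
      have hσc : sigmaHalf (ν * c) ≤ sigmaHalf ν * 2 :=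
        (sigmaHalf_mul_le ν c).trans (mul_le_mul_of_nonneg_left (sigmaHalf_prime_le_two hcp) hσ)
      have hlogν : Real.log (y / L) ≤ Real.log (y / ν) :=
        Real.log_le_log (by linarith) (div_le_div_of_nonneg_left (by linarith) (by linarith) hνL')
      have hlogν0 : 0 < Real.log (y / ν) := lt_of_lt_of_le hlogyL hlogν
      calc (ν.divisors.card : ℝ) * (|K₂₄| * sigmaHalf (ν * c) / Real.log (y / ν) ^ 6)
          ≤ (ν.divisors.card : ℝ) * (|K₂₄| * (sigmaHalf ν * 2) / Real.log (y / L) ^ 6) := by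
            refine mul_le_mul_of_nonneg_left ?_ hτ
            calc |K₂₄| * sigmaHalf (ν * c) / Real.log (y / ↑ν) ^ 6
                ≤ |K₂₄| * (sigmaHalf ν * 2) / Real.log (y / ↑ν) ^ 6 := by gcongr
              _ ≤ |K₂₄| * (sigmaHalf ν * 2) / Real.log (y / L) ^ 6 := by
                  refine div_le_div_of_nonneg_left (by positivity) (by positivity) ?_
                  gcongr
        _ = (ν.divisors.card : ℝ) * sigmaHalf ν * M₀ := by rw [hM₀]; ring
    -- nonnegativity of the `c`-weights
    have hcw : ∀ c ∈ (Icc 1 ⌊z⌋₊).filter Nat.Prime, 0 ≤ Real.log c * g (c / Nat.gcd c ν) := by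
      intro c hc
      obtain ⟨-, hcp⟩ := Finset.mem_filter.mp hc
      refine mul_nonneg (Real.log_nonneg (by exact_mod_cast hcp.one_lt.le)) ?_
      rw [Nat.Prime.div_gcd_eq hcp ν]
      split_ifs
      · rw [hg.map_one]; exact zero_le_one
      · exact hg0 c hcp
    -- the `c`-sum
    have hcsum := sum_primes_log_mul_density_div_gcd_le hg hK hνs hz
    have hlogν : Real.log ν ≤ Real.log L := Real.log_le_log (by linarith) hνL'
    have hcsum' : ∑ c ∈ (Icc 1 ⌊z⌋₊).filter Nat.Prime, Real.log c * g (c / Nat.gcd c ν) ≤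
        (K' + 1) * W := by
      refine hcsum.trans ?_
      rw [hW]
      nlinarith
    rw [abs_mul, abs_mul, abs_of_nonneg hgν]
    have hlamν : |(lam ν : ℝ)| ≤ 1 := by exact_mod_cast hlam ν
    calc |(lam ν : ℝ)| * g ν *
          |∑ c ∈ (Icc 1 ⌊z⌋₊).filter Nat.Prime, Real.log c * g (c / Nat.gcd c ν) *
            ∑ b ∈ (Icc 1 ⌊y⌋₊).filter (fun b => Squarefree b ∧ b.Coprime c),
              (μ b : ℝ) * g (b / Nat.gcd b ν)|
        ≤ 1 * g ν * ∑ c ∈ (Icc 1 ⌊z⌋₊).filter Nat.Prime, Real.log c * g (c / Nat.gcd c ν) *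
            ((ν.divisors.card : ℝ) * sigmaHalf ν * M₀) := by
          refine mul_le_mul (mul_le_mul_of_nonneg_right hlamν hgν) ?_ (abs_nonneg _)
            (mul_nonneg zero_le_one hgν)
          refine (Finset.abs_sum_le_sum_abs _ _).trans (Finset.sum_le_sum fun c hc => ?_)
          rw [abs_mul, abs_of_nonneg (hcw c hc)]
          exact mul_le_mul_of_nonneg_left (hb c hc) (hcw c hc)
      _ = g ν * ((ν.divisors.card : ℝ) * sigmaHalf ν * M₀) *
            ∑ c ∈ (Icc 1 ⌊z⌋₊).filter Nat.Prime, Real.log c * g (c / Nat.gcd c ν) := by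
          rw [← Finset.sum_mul]; ring
      _ ≤ g ν * ((ν.divisors.card : ℝ) * sigmaHalf ν * M₀) * ((K' + 1) * W) :=
          mul_le_mul_of_nonneg_left hcsum' (by positivity)
      _ = g ν * (ν.divisors.card : ℝ) * sigmaHalf ν * (M₀ * ((K' + 1) * W)) := by ring
  -- sum over `ν`
  have hE := sum_squarefree_density_card_sigmaHalf_le hg hK h19 hLfloor
  calc |∑ ν ∈ (Icc 1 ⌊L⌋₊).filter Squarefree, (lam ν : ℝ) * g ν *
        ∑ c ∈ (Icc 1 ⌊z⌋₊).filter Nat.Prime, Real.log c * g (c / Nat.gcd c ν) *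
          ∑ b ∈ (Icc 1 ⌊y⌋₊).filter (fun b => Squarefree b ∧ b.Coprime c),
            (μ b : ℝ) * g (b / Nat.gcd b ν)|
      ≤ ∑ ν ∈ (Icc 1 ⌊L⌋₊).filter Squarefree,
          g ν * (ν.divisors.card : ℝ) * sigmaHalf ν * (M₀ * ((K' + 1) * W)) :=
        (Finset.abs_sum_le_sum_abs _ _).trans (Finset.sum_le_sum hν_bound)
    _ = (∑ ν ∈ (Icc 1 ⌊L⌋₊).filter Squarefree, g ν * (ν.divisors.card : ℝ) * sigmaHalf ν) *
          (M₀ * ((K' + 1) * W)) := by rw [Finset.sum_mul]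
    _ ≤ Real.exp (2 * (|c₉| + |K₉| / Real.log 2 ^ 10) + 6 * K') * Real.log ⌊L⌋₊ ^ 2 *
          (M₀ * ((K' + 1) * W)) := mul_le_mul_of_nonneg_right hE (by positivity)



/-! ### The estimate (5.1) -/

/-- Elementary: if `|M| ≤ C₁/l³`, `|R| ≤ l · (K S/l³)`, `S ≥ 0`, `C₁ ≥ 0`, `l ≥ 1`, then
`|S M + R| ≤ (C₁ + K) S / l²`. [folklore] -/
theorem abs_size_mul_add_le {S M R C₁ K l : ℝ} (hS : 0 ≤ S) (hC₁ : 0 ≤ C₁) (hl : 1 ≤ l)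
    (hM : |M| ≤ C₁ / l ^ 3) (hR : |R| ≤ l * (K * S / l ^ 3)) :
    |S * M + R| ≤ (C₁ + K) * S / l ^ 2 := by
  have hl0 : 0 < l := by linarith
  have h1 : |S * M| ≤ C₁ * S / l ^ 2 := by
    rw [abs_mul, abs_of_nonneg hS]
    calc S * |M| ≤ S * (C₁ / l ^ 3) := mul_le_mul_of_nonneg_left hM hS
      _ = C₁ * S / l ^ 2 * (1 / l) := by field_simp
      _ ≤ C₁ * S / l ^ 2 := mul_le_of_le_one_right (by positivity) (by rw [div_le_one hl0]; exact hl)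
  have h2 : l * (K * S / l ^ 3) = K * S / l ^ 2 := by field_simp
  calc |S * M + R| ≤ |S * M| + |R| := abs_add_le _ _
    _ ≤ C₁ * S / l ^ 2 + K * S / l ^ 2 := add_le_add h1 (hR.trans_eq h2)
    _ = (C₁ + K) * S / l ^ 2 := by ring

/-- **FI (5.1) from (2.4)** (discharge of `fi_asp_Tyz_estimate` modulo the Möbius–density
cancellation `fi_moebius_density_cancellation` = FI (2.4), using the PROVED reduction
`fi_reduced_remainder_bound_holds` = FI (R′)). FI §5: insert (1.7) into
`T(x; y, z) = ∑_{b ≤ y} μ(b) ∑_{c ≤ z} Λ(c) ∑_ν λ_ν A_{[ν, bc]}(x)`; the main terms are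
`A(x) ∑_ν λ_ν g(ν) ∑_b μ(b) g(b/(ν,b)) ∑^♭_{c ∤ b} Λ(c) g(c/(ν,c)) ≪ A(x) ∑_ν g(ν)τ(ν)σ_ν (log y)^{-6}
log(νz) ≪ A(x)(log x)^{-3}` by (2.4), (1.8) (and (1.9) for `∑_ν`), the remainder terms are
`≤ (log yz) ∑_ν ∑^♭_{d ≤ yz} |r_{[ν,d]}(x)| ≪ A(x)(log x)^{-2}` by (R′) since `yzΔ ≤ e²Δ⁻¹D ≤ D`
(here `Δ = x^{θ/2}`, `y, z ∈ [Y, eY]`, `Y = Δ⁻¹√D`). [cite: FriedlanderIwaniecASP1998, §5 (5.1)] -/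
theorem fi_asp_Tyz_estimate_of_cancellation (h24 : fi_moebius_density_cancellation) :
    fi_asp_Tyz_estimate := by
  intro A D α θ θ₁ lam hreg
  classical
  have hhyp := hreg.hyp
  obtain ⟨K, hK⟩ := hhyp.2.2.2.1
  obtain ⟨c₉, K₉, h19⟩ := hhyp.2.2.2.2.1
  obtain ⟨K₂₄, h24'⟩ := h24 A.density A.density_mult ⟨K, hK⟩ ⟨c₉, K₉, h19⟩
  obtain ⟨K_R, hR'⟩ := fi_reduced_remainder_bound_holds A D _ _ hhyp
  have hθ : 0 < θ := by linarith [hreg.θ₁_pos, hreg.θ₁_le]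
  have hθ3 : θ < 1 / 3 := hreg.θ_lt
  have hκ0 : 0 < 1 / 3 - θ := by linarith
  set K' := max K 0 with hK'
  set E := Real.exp (2 * (|c₉| + |K₉| / Real.log 2 ^ 10) + 6 * K') with hE
  set C₁ := E * (2 * |K₂₄| / (1 / 3 - θ) ^ 6 * ((K' + 1) * 3)) with hC₁
  have hK'0 : 0 ≤ K' := le_max_right _ _
  have hE0 : 0 < E := Real.exp_pos _
  have hC₁0 : 0 ≤ C₁ := by positivity
  refine ⟨C₁ + K_R, ?_⟩
  have hR1 : ∀ᶠ x : ℝ in atTop, x ^ (2 / 3 : ℝ) < D x ∧ D x < x :=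
    hhyp.2.2.2.2.2.2.1.mono fun x hx => ⟨hx.1, hx.2.1⟩
  filter_upwards [hreg.weights, hR', hR1, eventually_exp_mul_fiY_le_sqrt hθ hR1,
    eventually_ge_atTop (4 : ℝ), eventually_ge_atTop (Real.exp 1),
    (tendsto_rpow_atTop (half_pos hθ)).eventually_ge_atTop (Real.exp 2),
    (tendsto_rpow_atTop hκ0).eventually_ge_atTop (2 : ℝ)]
    with x hw hRx hR1x heY hx4 hxe hxθ hxκ
  intro y hYy hyY z hYz hzY
  -- elementary facts about the parameters
  have hx0 : 0 < x := by linarith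
  have hx1 : 1 ≤ x := by linarith
  have hlogx : 1 ≤ Real.log x := by rw [Real.le_log_iff_exp_le hx0]; exact hxe
  have hlogx0 : 0 < Real.log x := by linarith
  have hD0 : 0 < D x := lt_trans (by positivity) hR1x.1
  have hDx : D x ≤ x := hR1x.2.le
  set L := x ^ (θ / 2) with hLdef
  have hL0 : 0 < L := Real.rpow_pos_of_pos hx0 _
  have he2 : (2 : ℝ) ≤ Real.exp 2 := by linarith [Real.add_one_le_exp (2 : ℝ)]
  have hL2 : 2 ≤ L := he2.trans hxθ
  have hLx : L ≤ x := by
    calc L = x ^ (θ / 2) := rfl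
      _ ≤ x ^ (1 : ℝ) := Real.rpow_le_rpow_of_exponent_le hx1 (by linarith)
      _ = x := Real.rpow_one x
  obtain ⟨hY0, hYge⟩ :=
    fiY_pos_and_ge (D := D) (θ := θ) (θ₁ := 1 / 3 - θ / 2) hx1 hR1x.1 le_rfl
  have hsplit : x ^ (1 / 3 - θ / 2 : ℝ) = x ^ (1 / 3 - θ : ℝ) * L := by
    rw [hLdef, ← Real.rpow_add hx0]
    congr 1
    ring
  have hY2L : 2 * L ≤ fiY D θ x := by
    calc 2 * L ≤ x ^ (1 / 3 - θ : ℝ) * L := mul_le_mul_of_nonneg_right hxκ hL0.le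
      _ = x ^ (1 / 3 - θ / 2 : ℝ) := hsplit.symm
      _ ≤ fiY D θ x := hYge
  have hsqrt_le : Real.sqrt x ≤ x := Real.sqrt_le_self_iff.mpr (Or.inr hx1)
  have heYx : Real.exp 1 * fiY D θ x ≤ x := heY.trans hsqrt_le
  have hy0 : 0 ≤ y := hY0.le.trans hYy
  have hyx : y ≤ x := hyY.trans heYx
  have hz0 : 0 ≤ z := hY0.le.trans hYz
  have hzx : z ≤ x := hzY.trans heYx
  have hz1 : 1 ≤ z := by linarith
  have hyL : 2 * L ≤ y := hY2L.trans hYy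
  -- the box `⌊y⌋ ⌊z⌋ ⌊L⌋ ≤ e² Y² L = e² D / L ≤ D`
  have hYdef : fiY D θ x = Real.sqrt (D x) / L := by rw [hLdef]; rfl
  have hYY : fiY D θ x * fiY D θ x = D x / (L * L) := by
    rw [hYdef, div_mul_div_comm, Real.mul_self_sqrt hD0.le]
  have hexp : Real.exp 1 * Real.exp 1 = Real.exp 2 := by rw [← Real.exp_add]; norm_num
  have hbox : (((⌊y⌋₊ * ⌊z⌋₊ * ⌊L⌋₊ : ℕ)) : ℝ) ≤ D x := by
    push_cast
    calc (⌊y⌋₊ : ℝ) * ⌊z⌋₊ * ⌊L⌋₊ ≤ y * z * L :=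
          mul_le_mul (mul_le_mul (Nat.floor_le hy0) (Nat.floor_le hz0) (Nat.cast_nonneg _) hy0)
            (Nat.floor_le hL0.le) (Nat.cast_nonneg _) (mul_nonneg hy0 hz0)
      _ ≤ (Real.exp 1 * fiY D θ x) * (Real.exp 1 * fiY D θ x) * L :=
          mul_le_mul_of_nonneg_right
            (mul_le_mul hyY hzY hz0 (mul_nonneg (Real.exp_pos 1).le hY0.le)) hL0.le
      _ = Real.exp 2 * (D x / (L * L)) * L := by rw [← hexp, ← hYY]; ring
      _ ≤ L * (D x / (L * L)) * L :=
          mul_le_mul_of_nonneg_right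
            (mul_le_mul_of_nonneg_right hxθ (div_nonneg hD0.le (by positivity))) hL0.le
      _ = D x := by field_simp
  -- the decomposition, the main terms and the remainder terms
  have hlam1 : ∀ ν, |lam x ν| ≤ 1 := hw.abs_le_one
  have hdec := hhyp.fiTyz_eq_main_add_rem hw hy0 hyx hz0 hzx hL0.le hLx
  have hMT := abs_fi_mainTerms_le A.density_mult hK h19 h24' hlam1 hL2 hyL hz1
  have hRT := A.abs_fiTyz_remTerms_le hlam1 hbox hDx
  have hRx' := hRx x le_rfl
  have hA0 : 0 ≤ A.size x := by rw [hhyp.size_eq]; exact A.congrSum_nonneg 1 x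
  -- numerics of the main-term bound: `≤ C₁ / (log x)³`
  have hLfloor2 : (2 : ℝ) ≤ (⌊L⌋₊ : ℕ) := by
    have : (2 : ℕ) ≤ ⌊L⌋₊ := Nat.le_floor (by exact_mod_cast hL2)
    exact_mod_cast this
  have hlogL : Real.log ⌊L⌋₊ ≤ Real.log x :=
    Real.log_le_log (by linarith) ((Nat.floor_le hL0.le).trans hLx)
  have hlogL0 : 0 ≤ Real.log ⌊L⌋₊ := Real.log_nonneg (by linarith)
  have hlogyL : (1 / 3 - θ) * Real.log x ≤ Real.log (y / L) := by
    have h1 : x ^ (1 / 3 - θ : ℝ) ≤ y / L := by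
      rw [le_div_iff₀ hL0]
      calc x ^ (1 / 3 - θ : ℝ) * L = x ^ (1 / 3 - θ / 2 : ℝ) := hsplit.symm
        _ ≤ fiY D θ x := hYge
        _ ≤ y := hYy
    have := Real.log_le_log (Real.rpow_pos_of_pos hx0 _) h1
    rwa [Real.log_rpow hx0] at this
  have hκl0 : 0 < (1 / 3 - θ) * Real.log x := mul_pos hκ0 hlogx0
  have hW0 : 0 ≤ Real.log z + Real.log 4 + Real.log L := by
    have h1 : 0 ≤ Real.log z := Real.log_nonneg hz1
    have h2 : 0 ≤ Real.log 4 := Real.log_nonneg (by norm_num)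
    have h3 : 0 ≤ Real.log L := Real.log_nonneg (by linarith)
    linarith
  have hW : Real.log z + Real.log 4 + Real.log L ≤ 3 * Real.log x := by
    have h1 : Real.log z ≤ Real.log x := Real.log_le_log (by linarith) hzx
    have h2 : Real.log 4 ≤ Real.log x := Real.log_le_log (by norm_num) hx4
    have h3 : Real.log L ≤ Real.log x := Real.log_le_log hL0 hLx
    linarith
  have hmain : E * Real.log ⌊L⌋₊ ^ 2 *
      (2 * |K₂₄| / Real.log (y / L) ^ 6 * ((K' + 1) * (Real.log z + Real.log 4 + Real.log L))) ≤
      C₁ / Real.log x ^ 3 := by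
    have h1 : Real.log ⌊L⌋₊ ^ 2 ≤ Real.log x ^ 2 := pow_le_pow_left₀ hlogL0 hlogL 2
    have h2 : 2 * |K₂₄| / Real.log (y / L) ^ 6 ≤ 2 * |K₂₄| / ((1 / 3 - θ) * Real.log x) ^ 6 :=
      div_le_div_of_nonneg_left (by positivity) (pow_pos hκl0 6)
        (pow_le_pow_left₀ hκl0.le hlogyL 6)
    have h3 : (K' + 1) * (Real.log z + Real.log 4 + Real.log L) ≤ (K' + 1) * (3 * Real.log x) :=
      mul_le_mul_of_nonneg_left hW (by positivity)
    have h20 : 0 ≤ 2 * |K₂₄| / Real.log (y / L) ^ 6 :=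
      div_nonneg (by positivity) (pow_nonneg (hκl0.le.trans hlogyL) 6)
    calc E * Real.log ⌊L⌋₊ ^ 2 *
          (2 * |K₂₄| / Real.log (y / L) ^ 6 * ((K' + 1) * (Real.log z + Real.log 4 + Real.log L)))
        ≤ E * Real.log x ^ 2 *
          (2 * |K₂₄| / ((1 / 3 - θ) * Real.log x) ^ 6 * ((K' + 1) * (3 * Real.log x))) :=
          mul_le_mul (mul_le_mul_of_nonneg_left h1 hE0.le)
            (mul_le_mul h2 h3 (mul_nonneg (by positivity) hW0) (h20.trans h2))
            (mul_nonneg h20 (mul_nonneg (by positivity) hW0)) (by positivity)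
      _ = C₁ / Real.log x ^ 3 := by
          rw [hC₁]
          field_simp
  -- combine
  rw [hdec]
  refine abs_size_mul_add_le hA0 hC₁0 hlogx ?_ (hRT.trans (mul_le_mul_of_nonneg_left hRx' hlogx0.le))
  rw [fi_mainTerms_eq A.density_mult (lam x) ⌊y⌋₊ ⌊z⌋₊ ⌊L⌋₊]
  exact hMT.trans hmain


end Literature.NumberTheory.Sieve
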